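import Literature.MathematicalPhysics.QuantumFieldTheory.Balaban1983to89.B4Thm110ZeroBox

/-!
# `Balaban1983to89.B4Thm110ZeroBoxDeriv` — B4 «Theorem (Proposition 2.1 of [1])», the DERIVATIVE CLAUSE of (1.10),
# PROVED at `A = 0` on RECTANGULAR PARALLELEPIPEDS for ALL scales `k ≥ 1`:
# `|(D^η_{0,μ}G_k(□)f)(x)| ≤ c₀e^{−δ₀dist(x, supp f)}‖f‖_∞`, `G_k(□) = (−Δ^{η,N}_□ + m² + a_kP_k)^{-1}`, `η = L^{-k}`,
# `(D^η_{0,μ}φ)(x) = η^{-1}(φ(x + ηe_μ) − φ(x))`, by the print's own box route (2.34)/(2.38)–(2.39) + Lemma 2.4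

**Source.** T. Bałaban, *Regularity and Decay of Lattice Green's Functions*, Commun. Math. Phys. **89**, 571–597 (1983)
(bib key `Balaban1983RegularityDecay`, «B4» of the 1983–89 series): p. 572 [PDF 2] (1.2)–(1.6), p. 573 [PDF 3] the
difference derivative `∂^η_μ` and the Theorem with (1.9)–(1.10), pp. 577–578 [PDF 7–8] Lemma 2.2 (2.16)–(2.17),
p. 582 [PDF 12] (2.34), Lemma 2.4 (2.35)–(2.37) and (2.38)–(2.39), p. 583 [PDF 13] the proof remarks, p. 584 [PDF 14]
(journal page = PDF page + 570; renders `b2b-balaban-ref1/pages/1983-cmp89-regularity-decay/1983-cmp89-regularity-decay-p002-x2.png`,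
`-p003`, `-p007`, `-p008`, `-p012`, `-p013`, `-p014-x2.png`, read as images).  A new leaf on top of
`B4Thm110ZeroBox` (the VALUE clause of (1.10), whose scale-`j` objects `𝒢_j`, `A_j`, `B_j`, `C_j`, the recursion
`Gfine_succ_sub` and the one-step base `boxOpR_L_inv_decay` are USED BY NAME) and of `B4TwoBox120.green_blockRowDiff_bound`
(the derivative half of (2.35), kernel-proved in `B4Green242Bridge.greenBoxQ_deriv_decay_235_inv`); no existing module is
touched; nothing of B4 is asserted as a fact.

## WHAT IS PRINTED (verbatim; `≦` of the print written `≤`)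

p. 572: «U(A) = e^{qeηA},   (1.2)» […] «⟨φ, (−Δ^{η,N}_{A,Ω})φ⟩ = Σ_{b⊂Ω} η^d|(D^η_Aφ)(b)|² = Σ_{b⊂Ω} η^d|η^{−1}(U(A_b)φ(b₊) − φ(b₋))|²,   (1.3)
where the summation is over the set of all bonds b = ⟨b₋, b₊⟩ with end-points b₋, b₊ in Ω.» […] «Here we have used
the identification A_{⟨x,x+ηe_μ⟩} = A_μ(x), where e_μ is a unit vector of μ^th axis.» […]
«G_k(Ω, A) = (−Δ^{η,N}_{A,Ω} + m² + aP_k(A))^{−1},   (1.6)  where m² ≥ 0 and a is a positive constant close to 1».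

p. 573: «[Of course ∂^η_μ is a difference derivative defined by (∂^η_μA)(x) = η^{−1}(A(x + ηe_μ) − A(x)).]» […]
«**Theorem** (Proposition 2.1 of [1]). For α < 1 there exist positive constants δ₀, c₀, R₀ independent of A, k, Ω and
depending on d, M only, c₀ on α also, such that for e sufficiently small and for an arbitrary function f : Ω → R^N, we
have […] (1.9) […]. Similarly
|(D^η_{A,μ}G_k(Ω, A)f)(x)|, |(G_k(Ω, A)(x)| ≤ c₀ exp(−δ₀ dist(x, supp f))‖f‖_∞   (1.10)
for x ∈ Ω, dist(x, Ω^c) ≥ R₀.» […] «For some simple sets Ω, e.g. for rectangular parallelepipeds, the inequalities hold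
without any restrictions on the points x, x′, i.e. for all x, x′ ∈ Ω.»

pp. 577–578: «**Lemma 2.2.** Let a rectangular parallelepiped □ be a sum of few large blocks […], and let Ã be a regular
vector field configuration […]. Then for e sufficiently small and α < 1, there exists a constant c₁ depending on d, α
only, such that ‖G_k(□, Ã)f‖_{1,α} ≤ c₁‖f‖_∞,   (2.16)  and a constant c₂ depending on d, p₁, such that
‖G_k(□, Ã)f‖_q, ‖D^η_{Ã,μ}G_k(□, Ã)f‖_q, ‖G_k(□, Ã)D^{η*}_{Ã,μ}f‖_q ≤ c₂‖f‖_p   (2.17)  for 1 ≤ p, q ≤ ∞, satisfying the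
condition 1/p − 1/p₁ ≤ 1/q ≤ 1/p with p₁ > d.»

p. 582: «This proof is based on renormalization group equations (2.43) of [1] rescaled to the η-lattice:
G_k(□) = C^{(0),η}(□) + Σ_{j=1}^{k−1} a_j²(L^jη)^{−4}G_j^η(□)Q_j^*C^{(j),L^jη}(□)Q_jG_j^η(□).   (2.34)» […]
«**Lemma 2.4.** There exist positive constants c₀, δ₀, and for α < 1, there exists a constant c₁, such that
|(G_j(□)Q_j^*)(x, y)|, |(∂^{L^{−j}}_μG_j(□)Q_j^*)(x, y)| ≤ c₀e^{−δ₀|x−y|},   (2.35) […] |C^{(j)}(□; y, y′)| ≤ c₀e^{−δ₀|y−y′|},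
(2.37)  for arbitrary non-negative integer j, arbitrary, rectangular parallelepiped □ ⊂ L^{−j}Z^d built of large
blocks, and x, x′ ∈ □, y, y′ ∈ □^{(j)} = □∩Z^d.» — followed by (2.38) («We use (2.34) with j^th term rescaled to the
L^{−j}-lattice»: the j-th term carries the factor (L^jη)^{1−α}) and (2.39) «≤ O(1) Σ_{j=0}^{k−1} (L^jη)^{1−α}‖f‖_∞ ≤ c′₁‖f‖_∞».

p. 583: «where the constant c′₁ is built of c₀, c₁, Σ_{x∈Z^d} e^{−δ₀|x|}, Σ_{j=1}^∞ (L^{−j})^{1−α}. We estimate in the same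
way |(G_k(□)f)(x)|, |(∂^η_μG_k(□)f)(x)|, and we get (2.16).» […] «*Remark.* Let us mention here that the above method can
be used also to prove pointwise estimates of G_k(□), G_k(□, A), and even G_k(Ω, A), their derivatives and
"Hölder-derivatives".» […] «Now we will prove the inequality (2.17) for G_k(□). For q = p = ∞, it is a special case of
(2.16), but for lack of dependence on α, and was proved above. For q = p = 1 we get it by duality argument, i.e. using
the fact that the space L^∞(□) is adjoint to L^1(□).»

p. 584: «This part of the argument is valid for an arbitrary rectangular parallelepiped □ built of unit blocks, so the
inequalities are valid for all such sets.»

## WHAT THIS FILE CERTIFIES (kernel-checked, zero `sorry`, no hypotheses; the lineage is USED BY NAME, not re-proved)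

For every dimension `d + 1`, every `L = ℓ + 1 ≥ 2` and every window `a ∈ [a₋, a₊]` (`a₋ > 0`), `m² ∈ [0, m²₊]` there
are `δ₀ > 0`, `c₀ > 0` such that for EVERY scale `k ≥ 1` (`η = L^{-k}`), every `(a, m²)` in the window, every box
`□ = Π_μ[0, M_μ)` with integer sides `M_μ ≥ 1`, every axis `μ` and every pair of fine-lattice NEIGHBOURS `x, xe = x + e_μ`
of `□ ∩ ηℤ^{d+1}` (lattice units; `xe.1 = x.1 + Pi.single μ 1`), the propagator `G = G_k(□) =
(B4BoxCov237.boxOpR (L^k) a_k m² M)⁻¹` obeys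
* `thm110_zero_box_deriv_roww` (§6, the master estimate):
  `Σ_{x′} |L^k(G(xe, x′) − G(x, x′))|·e^{δ₀η|x−x′|_∞} ≤ c₀`;
* `thm110_zero_box_deriv_value` / `thm110_zero_box_deriv_dist` (§7) — **THE DERIVATIVE CLAUSE OF (1.10) for rectangular
  parallelepipeds, with no restriction on `x`**: `|L^k((Gf)(xe) − (Gf)(x))| ≤ c₀·e^{−δ₀ηD}·F` for every `f`, every
  `F ≥ |f|` pointwise and every `D ≤ |x − x′|_∞ (x′ ∈ supp f)`, in particular `D = dsupp f x`;
* `lemma22_zero_box_deriv_rowSum` / `…_deriv_sup` / `…_derivAdj_colSum` (§7) — **LEMMA 2.2 (2.17) AT `A = 0` for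
  `D^η_μG_k(□)` at `p = q = ∞` and for `G_k(□)D^{η*}_μ` at `p = q = 1`** (the transposed kernel, symmetry of `G`), and the
  `sup|∂^η_μG_k(□)f|` estimate of p. 583: `Σ_{x′}|L^k(G(xe,x′) − G(x,x′))| ≤ c₀`, `|L^k((Gf)(xe) − (Gf)(x))| ≤ c₀‖f‖_∞`,
  `Σ_{x′}|L^k(G(x′,xe) − G(x′,x))| ≤ c₀`;
* `thm110_zero_box_deriv_roww_coeff` / `thm110_zero_box_deriv_value_coeff` (§7) — the same for the operator with the
  LITERAL coefficient `a` of (1.6) ranging over the window (instead of the running `a_k = B1.aSeq a L k`);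
* §8: the statements are instantiated at `d + 1 = 4`, `L = 2`, `a ∈ [1/2, 2]`, `m² ∈ [0, 1]` and their binders are
  inhabited (`k = 1`, the unit cube, `x = 0`, `xe = e_0`), so nothing is vacuous.
On the way: the weighted `ℓ¹` functional of a vector about a base point and its bookkeeping (§1, `wsum`), the general
triple-product estimate behind (2.38)–(2.39) with entry bounds as hypotheses (§2, `wsum_gCB_le`), the transport of the
derivative half of (2.35) to the fine box with the factor `s_j^{-1}` (§3, `Gfine_blockRowDiff_bound`), the differenced step
bound `≤ Θe^{δ₀}L^{-(k-j)}` (§4, `step_termD_bound`) and the induction over `j` (§5, `Gfine_rowwD_bound`).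

## DICTIONARY (typist's; each line is a reading, not a quotation; everything at `A = 0`, `U ≡ 1`, one component;
the dictionary of `B4Thm110ZeroBox` for `□`, `G_k(□)`, `a_k`, `‖f‖_∞`, `dist(x, supp f)`, (2.34) applies verbatim)

* `(D^η_{A,μ}φ)(x)` of (1.3)/(1.9)/(1.10) at `A = 0` (`U(A_b) = 1` by (1.2)): `(D^η_{0,μ}φ)(x) = (D^η_0φ)(⟨x, x + ηe_μ⟩)
  = η^{-1}(φ(x + ηe_μ) − φ(x)) = (∂^η_μφ)(x)` (p. 573) ↦ `L^k·(φ xe − φ x)` for a pair of sites `x, xe` of the fine box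
  with `xe.1 = x.1 + Pi.single μ 1` (lattice units, `η^{-1} = L^k`); the bond `⟨x, x + ηe_μ⟩` must lie in `□` («bonds
  b ⊂ Ω», (1.3)), i.e. BOTH end-points are sites of the box — this is the binder `(x xe : ↥(boxDom …))`.
* `(D^η_{0,μ}G_k(□)f)(x)` ↦ `L^k·(((boxOpR …)⁻¹ *ᵥ f) xe − ((boxOpR …)⁻¹ *ᵥ f) x)`; the kernel of `D^η_μG_k(□)` ↦
  `(x, x′) ↦ L^k(G(xe,x′) − G(x,x′))`, that of `G_k(□)D^{η*}_μ` (adjoint w.r.t. the site/bond counting measures) ↦ its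
  transpose `(x′, ⟨x,xe⟩) ↦ L^k(G(x′,xe) − G(x′,x))`.
* `∂^{L^{-j}}_μG_j(□)Q_j^*` of (2.35) ↦ the differenced block-row sums `b_j·Σ_{x′ ∈ B(y)}(G_j(□)(xe,x′) − G_j(□)(x,x′))`
  of `B4TwoBox120.green_blockRowDiff_bound` (unit `L^{-j}`-lattice difference quotient = `b_j = L^j` times the
  site difference), transported to `𝒢_j = s_j^{-2}G_j(□)` on the fine box with `L^k = s_jb_j` (§3).
* «constants depending on d, M only» ↦ `∃ δ₀ c₀` depending on `d`, `ℓ` and the window only — uniform in `k ≥ 1`, in the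
  box, in the axis `μ`, in the pair `x, xe` and in `(a, m²)`.

## HONEST SCOPE — what is NOT certified here

(i) Only `A = 0` (so `D^η_{A,μ} = ∂^η_μ`, «e sufficiently small» and regularity are void, one component).  (ii) Only
`Ω = □ = Π_μ[0, M_μ)` with integer sides (unions of UNIT blocks, p. 584); general `Ω` with `dist(x, Ω^c) ≥ R₀` (the
random-walk expansion of Sect. 2) is NOT treated.  (iii) Only the FORWARD covariant derivative along bonds of `□` in the
ROW variable: the pointwise DERIVATIVE clause of (1.10), (2.17) for `D^η_μG_k` at `p = q = ∞` and for `G_kD^{η*}_μ` at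
`p = q = 1`; NOT the Hölder quotient (1.9)/(2.16) (`α > 0`), NOT (2.17) for `D^η_μG_k` at `p = q = 1` or for `G_kD^{η*}_μ`
at `p = q = ∞` (these need column sums of the differenced kernel over the bond variable, which the row recursion used
here does not control), NOT the `L^p → L^q` scale, NOT (1.11)–(1.12).  The value clause is `B4Thm110ZeroBox`.  (iv) The
constants are existential and depend on `d`, `ℓ` and the window (print: «on d, M only»); the decay rate is `δ₀` per unit
of `η`-scaled sup distance (Euclidean `≥` sup, so the printed form follows with `δ₀/√(d+1)`).  (v) ROUTE: the print's
box route of pp. 582–583 — (2.34) one step at a time (`B4Thm110ZeroBox.Gfine_succ_sub`), differenced in the row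
variable, with the derivative half of (2.35) in block-row form (`B4TwoBox120.green_blockRowDiff_bound`), the value half
(`B4Thm110ZeroBox.Gfine_blockRow_bound`) and (2.37) (`B4BoxCov237.cov237_box_decay`) as kernel-proved inputs; the
`j`-th step costs `L^{-(k-j)}` (the `(L^jη)^{1-α}` of (2.38)–(2.39) at `α = 0`) instead of the `L^{-2(k-j)}` of the value
clause, and the `j = 1` start is the one-step box Green's function of `B4Thm110ZeroBox` §7 differenced crudely
(`|∇𝒢_1| ≤ |𝒢_1(xe,·)| + |𝒢_1(x,·)|`, `L^k·s_1^{-2} ≤ L`) — it is NOT the print's general proof of Proposition 2.1.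
(vi) This file does not touch `DagBinding`/`DagDischarged` (the carver's) nor `B4Prop31Zero`; whether and how the
abstract `B4.ThmPrinted` of the binding is instantiated from it is the carver's call.

**Value = kernel certificate (the print's (1.10) derivative clause at `A = 0` on boxes, all scales, by the print's own
renormalization-group route over the package's `A = 0` theorems), NOT summit progress**: the Yang–Mills /
`Summit.QuantumFields` statements are untouched; no Literature fact is minted — every hypothesis used is kernel-proved
in this package.
-/

namespace Literature.MathematicalPhysics.QuantumFieldTheory.Balaban1983to89.B4Thm110ZeroBoxDeriv

open Finset Matrix
open Literature.MathematicalPhysics.QuantumFieldTheory.Balaban1983to89.B4ContourShift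
open Literature.MathematicalPhysics.QuantumFieldTheory.Balaban1983to89.B4Reflection242
open Literature.MathematicalPhysics.QuantumFieldTheory.Balaban1983to89.B4Green242Bridge
open Literature.MathematicalPhysics.QuantumFieldTheory.Balaban1983to89.B4BoxCov237
open Literature.MathematicalPhysics.QuantumFieldTheory.Balaban1983to89.B4Thm110ZeroBox
open B4Sect5Torus (IsPseudoDist SumBound Hyp56 rate rate_pos inv_decay)
open B4Sect5Proof (latticeConst latticeConst_nonneg latticeSum_le)

noncomputable section

variable {d : ℕ}

/-! ## §1 Lattice neighbours `xe = x + e_μ`, and weighted `ℓ¹` sums of vectors about a base point -/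

section WSum

variable {N : Fin (d + 1) → ℕ}

/-- `|e_μ|_∞ ≤ 1` for the unit vector `e_μ` of the `μ`-th axis («e_μ is a unit vector of μ^th axis», p. 572). [folklore] -/
theorem supNorm_single_le (μ : Fin (d + 1)) : supNorm (Pi.single μ (1 : ℤ) : Fin (d + 1) → ℤ) ≤ 1 := by
  refine supNorm_le_of_forall fun i => ?_
  by_cases h : i = μ
  · subst h
    simp
  · simp [h]

/-- for a lattice neighbour `xe = x + e_μ`: `|x − x′|_∞ ≤ |xe − x′|_∞ + 1`. [folklore] -/
theorem supNorm_sub_le_nbr {μ : Fin (d + 1)} {x xe x' : Fin (d + 1) → ℤ} (hxe : xe = x + Pi.single μ 1) :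
    supNorm (x - x') ≤ supNorm (xe - x') + 1 := by
  have h1 := supNorm_sub_le_sub_add_sub x xe x'
  have h2 : supNorm (x - xe) ≤ 1 := by
    rw [hxe, show x - (x + Pi.single μ 1) = -(Pi.single μ (1 : ℤ) : Fin (d + 1) → ℤ) from by abel,
      B4TorusKernel.supNorm_neg]
    exact supNorm_single_le μ
  linarith

/-- and `|xe − x′|_∞ ≤ |x − x′|_∞ + 1`. [folklore] -/
theorem supNorm_nbr_sub_le {μ : Fin (d + 1)} {x xe x' : Fin (d + 1) → ℤ} (hxe : xe = x + Pi.single μ 1) :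
    supNorm (xe - x') ≤ supNorm (x - x') + 1 := by
  have h1 := supNorm_sub_le_sub_add_sub xe x x'
  have h2 : supNorm (xe - x) ≤ 1 := by
    rw [hxe, show x + Pi.single μ 1 - x = (Pi.single μ (1 : ℤ) : Fin (d + 1) → ℤ) from by abel]
    exact supNorm_single_le μ
  linarith

/-- the WEIGHTED `ℓ¹` FUNCTIONAL OF A VECTOR about the base point `x`: `Σ_{x′} |g(x′)|·e^{δ₀|x − x′|_∞/n}`
(`n = L^k` fine points per unit length; the vector is a differenced kernel row below). [folklore] -/
def wsum (δ₀ : ℝ) (n : ℕ) (x : ↥(boxDom N)) (g : ↥(boxDom N) → ℝ) : ℝ :=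
  ∑ x', |g x'| * Real.exp (δ₀ * supNorm (x.1 - x'.1) / n)

/-- the weighted functional is nonnegative. [folklore] -/
theorem wsum_nonneg (δ₀ : ℝ) (n : ℕ) (x : ↥(boxDom N)) (g : ↥(boxDom N) → ℝ) : 0 ≤ wsum δ₀ n x g :=
  Finset.sum_nonneg fun _ _ => mul_nonneg (abs_nonneg _) (Real.exp_pos _).le

/-- subadditivity. [folklore] -/
theorem wsum_add_le (δ₀ : ℝ) (n : ℕ) (x : ↥(boxDom N)) (g h : ↥(boxDom N) → ℝ) :
    wsum δ₀ n x (fun x' => g x' + h x') ≤ wsum δ₀ n x g + wsum δ₀ n x h := by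
  unfold wsum
  rw [← Finset.sum_add_distrib]
  refine Finset.sum_le_sum fun x' _ => ?_
  rw [← add_mul]
  exact mul_le_mul_of_nonneg_right (abs_add_le _ _) (Real.exp_pos _).le

/-- homogeneity. [folklore] -/
theorem wsum_mul_left (δ₀ : ℝ) (n : ℕ) (x : ↥(boxDom N)) {c : ℝ} (hc : 0 ≤ c) (g : ↥(boxDom N) → ℝ) :
    wsum δ₀ n x (fun x' => c * g x') = c * wsum δ₀ n x g := by
  unfold wsum
  rw [Finset.mul_sum]
  refine Finset.sum_congr rfl fun x' _ => ?_
  rw [abs_mul, abs_of_nonneg hc, mul_assoc]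

/-- on the row `x` of a kernel the functional is the weighted row norm `roww` of `B4Thm110ZeroBox`. [folklore] -/
theorem wsum_row (δ₀ : ℝ) (n : ℕ) (T : Matrix ↥(boxDom N) ↥(boxDom N) ℝ) (x : ↥(boxDom N)) :
    wsum δ₀ n x (T x) = roww δ₀ n T x := rfl

/-- the plain `ℓ¹` sum is dominated by the weighted one (`δ₀ ≥ 0`). [folklore] -/
theorem sum_abs_le_wsum {δ₀ : ℝ} (hδ : 0 ≤ δ₀) (n : ℕ) (x : ↥(boxDom N)) (g : ↥(boxDom N) → ℝ) :
    ∑ x', |g x'| ≤ wsum δ₀ n x g := by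
  unfold wsum
  refine Finset.sum_le_sum fun x' _ => ?_
  have h1 : 1 ≤ Real.exp (δ₀ * supNorm (x.1 - x'.1) / n) :=
    Real.one_le_exp (div_nonneg (mul_nonneg hδ (supNorm_nonneg _)) (Nat.cast_nonneg n))
  calc |g x'| = |g x'| * 1 := (mul_one _).symm
    _ ≤ |g x'| * Real.exp (δ₀ * supNorm (x.1 - x'.1) / n) := mul_le_mul_of_nonneg_left h1 (abs_nonneg _)

/-- **ENTRYWISE EXPONENTIAL DECAY ABOUT `x` ⇒ WEIGHTED BOUND** (weight rate `δ₀/n ≤ r/2`), through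
`Σ_y e^{−(r/2)|x−y|_∞} ≤ K_{d+1}(r/2)` (`rho_sumBound`). [folklore] -/
theorem wsum_le_of_decay {n : ℕ} (hn : 1 ≤ n) (x : ↥(boxDom N)) {g : ↥(boxDom N) → ℝ} {C₀ r δ₀ : ℝ}
    (hC : 0 ≤ C₀) (hr : 0 < r) (hδ : 0 ≤ δ₀) (hδr : δ₀ ≤ r / 2)
    (hg : ∀ x', |g x'| ≤ C₀ * Real.exp (-(r * supNorm (x.1 - x'.1)))) :
    wsum δ₀ n x g ≤ C₀ * latticeConst (d + 1) (r / 2) := by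
  unfold wsum
  have hS := rho_sumBound N (r / 2) (half_pos hr) x
  have hn1 : (1 : ℝ) ≤ n := by exact_mod_cast hn
  calc ∑ x', |g x'| * Real.exp (δ₀ * supNorm (x.1 - x'.1) / n)
      ≤ ∑ x', C₀ * Real.exp (-(r / 2 * rho N x x')) := by
        refine Finset.sum_le_sum fun x' _ => ?_
        have hρ : 0 ≤ supNorm (x.1 - x'.1) := supNorm_nonneg _
        have hw : δ₀ * supNorm (x.1 - x'.1) / n ≤ r / 2 * supNorm (x.1 - x'.1) :=
          calc δ₀ * supNorm (x.1 - x'.1) / n ≤ δ₀ * supNorm (x.1 - x'.1) :=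
                div_le_self (mul_nonneg hδ hρ) hn1
            _ ≤ r / 2 * supNorm (x.1 - x'.1) := mul_le_mul_of_nonneg_right hδr hρ
        calc |g x'| * Real.exp (δ₀ * supNorm (x.1 - x'.1) / n)
            ≤ C₀ * Real.exp (-(r * supNorm (x.1 - x'.1))) * Real.exp (r / 2 * supNorm (x.1 - x'.1)) :=
              mul_le_mul (hg x') (Real.exp_le_exp.2 hw) (Real.exp_pos _).le
                (mul_nonneg hC (Real.exp_pos _).le)
          _ = C₀ * Real.exp (-(r / 2 * rho N x x')) := by
              unfold rho
              rw [mul_assoc, ← Real.exp_add]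
              congr 1
              congr 1
              ring
    _ = C₀ * ∑ x', Real.exp (-(r / 2 * rho N x x')) := by rw [Finset.mul_sum]
    _ ≤ C₀ * latticeConst (d + 1) (r / 2) := mul_le_mul_of_nonneg_left hS hC

/-- **FROM THE WEIGHTED BOUND TO THE PRINTED FORM**: if `Σ_{x′}|g(x′)|e^{δ₀|x−x′|_∞/n} ≤ c₀`, `|f| ≤ F` and
`D ≤ |x − x′|_∞` on `supp f`, then `|Σ_{x′} g(x′)f(x′)| ≤ c₀e^{−δ₀D/n}F`. [folklore] -/
theorem abs_sum_mul_le_of_wsum {δ₀ c₀ : ℝ} (hδ : 0 ≤ δ₀) (n : ℕ) (x : ↥(boxDom N)) (g : ↥(boxDom N) → ℝ)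
    (hw : wsum δ₀ n x g ≤ c₀) (f : ↥(boxDom N) → ℝ) {F D : ℝ}
    (hF : ∀ x', |f x'| ≤ F) (hD : ∀ x', f x' ≠ 0 → D ≤ supNorm (x.1 - x'.1)) :
    |∑ x', g x' * f x'| ≤ c₀ * Real.exp (-(δ₀ * D / n)) * F := by
  have hF0 : 0 ≤ F := (abs_nonneg _).trans (hF x)
  have h1 : |∑ x', g x' * f x'| ≤ ∑ x', |g x'| * |f x'| :=
    (Finset.abs_sum_le_sum_abs _ _).trans (le_of_eq (Finset.sum_congr rfl fun x' _ => abs_mul _ _))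
  have h2 : ∀ x', |g x'| * |f x'|
      ≤ |g x'| * Real.exp (δ₀ * supNorm (x.1 - x'.1) / n) * (Real.exp (-(δ₀ * D / n)) * F) := by
    intro x'
    by_cases hfx : f x' = 0
    · rw [hfx, abs_zero, mul_zero]
      positivity
    · have hDx := hD x' hfx
      have he : 1 ≤ Real.exp (δ₀ * supNorm (x.1 - x'.1) / n) * Real.exp (-(δ₀ * D / n)) := by
        rw [← Real.exp_add]
        apply Real.one_le_exp
        have h0 : 0 ≤ δ₀ * (supNorm (x.1 - x'.1) - D) / n :=
          div_nonneg (mul_nonneg hδ (sub_nonneg.2 hDx)) n.cast_nonneg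
        have heq : δ₀ * supNorm (x.1 - x'.1) / n + -(δ₀ * D / n) = δ₀ * (supNorm (x.1 - x'.1) - D) / n := by
          ring
        rw [heq]
        exact h0
      calc |g x'| * |f x'| ≤ |g x'| * F := mul_le_mul_of_nonneg_left (hF x') (abs_nonneg _)
        _ ≤ |g x'| * F * (Real.exp (δ₀ * supNorm (x.1 - x'.1) / n) * Real.exp (-(δ₀ * D / n))) :=
            le_mul_of_one_le_right (mul_nonneg (abs_nonneg _) hF0) he
        _ = _ := by ring
  calc |∑ x', g x' * f x'| ≤ ∑ x', |g x'| * |f x'| := h1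
    _ ≤ ∑ x', |g x'| * Real.exp (δ₀ * supNorm (x.1 - x'.1) / n) * (Real.exp (-(δ₀ * D / n)) * F) :=
        Finset.sum_le_sum fun x' _ => h2 x'
    _ = wsum δ₀ n x g * (Real.exp (-(δ₀ * D / n)) * F) := by rw [wsum, Finset.sum_mul]
    _ ≤ c₀ * (Real.exp (-(δ₀ * D / n)) * F) := mul_le_mul_of_nonneg_right hw (by positivity)
    _ = c₀ * Real.exp (-(δ₀ * D / n)) * F := by ring

end WSum

/-- weakening a decay rate: `e^{−κp} ≤ e^{−κ₁p}` for `κ₁ ≤ κ`, `p ≥ 0`. [folklore] -/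
theorem exp_rate_mono {κ₁ κ p : ℝ} (h : κ₁ ≤ κ) (hp : 0 ≤ p) :
    Real.exp (-(κ * p)) ≤ Real.exp (-(κ₁ * p)) :=
  Real.exp_le_exp.2 (by nlinarith)

/-- differencing a triple matrix product in the row index:
`t·((ACB)(p,x′) − (ACB)(q,x′)) = Σ_{y′}Σ_y (t(A(p,y) − A(q,y)))·C(y,y′)·B(y′,x′)`. [folklore] -/
theorem mul3_row_sub {α β γ ε : Type*} [Fintype β] [Fintype γ] (A : Matrix α β ℝ) (C : Matrix β γ ℝ)
    (B : Matrix γ ε ℝ) (p q : α) (x' : ε) (t : ℝ) :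
    t * ((A * C * B) p x' - (A * C * B) q x') = ∑ y', ∑ y, t * (A p y - A q y) * C y y' * B y' x' := by
  simp only [Matrix.mul_apply, Finset.sum_mul]
  rw [← Finset.sum_sub_distrib, Finset.mul_sum]
  refine Finset.sum_congr rfl fun y' _ => ?_
  rw [← Finset.sum_sub_distrib, Finset.mul_sum]
  refine Finset.sum_congr rfl fun y _ => ?_
  ring

/-! ## §2 The weighted row sum of a differenced fluctuation term: the general triple-product estimate

For a vector `g` on the scale-`j` unit box decaying about `blk_{b_j} x` (`|g(y)| ≤ c_A e^{−κ|blk x − y|}`), a unit × unit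
kernel `C` with `|C(y,y′)| ≤ c_C e^{−δ|y−y′|}` and a unit × fine kernel `B` with `b_j^{d+1}|B(y′,x′)| ≤ c_B e^{−κ|blk x′ − y′|}`,
the vector `x′ ↦ Σ_{y′,y} g(y)C(y,y′)B(y′,x′)` has weighted sum `≤ c_Ac_Cc_B·e^{δ₀}·K(κ/2)K(δ/2)K(κ/2)` for every
weight rate `δ₀ ≤ κ/2, δ/2` — the bookkeeping of [B4] (2.38)–(2.39) (weight absorbed by halving the rates through
`|x − x′| ≤ b_j(|blk x − y| + |y − y′| + |y′ − blk x′| + 1)` and `L^k = s_j b_j`; the fibre sum `Σ_{x′}` costs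
`b_j^{d+1}K`, cancelled by the normalisation of `B`).  This is the differenced twin of `B4Thm110ZeroBox.step_term_bound`'s
inner estimate, with the entry bounds as hypotheses. -/

section Triple

variable {ℓ k j : ℕ}

set_option maxHeartbeats 1600000 in
/-- **THE TRIPLE-PRODUCT ESTIMATE** (see the section docstring). [folklore] -/
theorem wsum_gCB_le (hj : j + 1 ≤ k) (M : Fin (d + 1) → ℕ) (x : ↥(boxDom (Nf ℓ k M)))
    (g : ↥(boxDom (Mj ℓ k M j)) → ℝ) (C : Matrix ↥(boxDom (Mj ℓ k M j)) ↥(boxDom (Mj ℓ k M j)) ℝ)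
    (B : Matrix ↥(boxDom (Mj ℓ k M j)) ↥(boxDom (Nf ℓ k M)) ℝ)
    {cA cC cB κ δ δ₀ : ℝ} (hcA : 0 ≤ cA) (hcC : 0 ≤ cC) (hcB : 0 ≤ cB) (hκ : 0 < κ) (hδ : 0 < δ)
    (hδ0 : 0 ≤ δ₀) (hδκ : δ₀ ≤ κ / 2) (hδδ : δ₀ ≤ δ / 2)
    (hg : ∀ y, |g y| ≤ cA * Real.exp (-(κ * supNorm (blk (bj ℓ j) x.1 - y.1))))
    (hC : ∀ y y', |C y y'| ≤ cC * Real.exp (-(δ * supNorm (y.1 - y'.1))))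
    (hB : ∀ y' x', |B y' x'| ≤ ((((bj ℓ j : ℕ) : ℝ)) ^ (d + 1))⁻¹ *
      (cB * Real.exp (-(κ * supNorm (blk (bj ℓ j) x'.1 - y'.1))))) :
    wsum δ₀ ((ℓ + 1) ^ k) x (fun x' => ∑ y', ∑ y, g y * C y y' * B y' x')
      ≤ cA * cC * cB * Real.exp δ₀
          * (latticeConst (d + 1) (κ / 2) * latticeConst (d + 1) (δ / 2) * latticeConst (d + 1) (κ / 2)) := by
  have hK0 : ∀ t : ℝ, 0 < t → 0 ≤ latticeConst (d + 1) t := fun t ht => latticeConst_nonneg _ ht.le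
  have hKκ := hK0 _ (half_pos hκ)
  have hKδ := hK0 _ (half_pos hδ)
  have hb1 : 1 ≤ bj ℓ j := bj_pos ℓ j
  have hbD : (0 : ℝ) < ((bj ℓ j : ℕ) : ℝ) ^ (d + 1) := by positivity
  have hbD0 : ((bj ℓ j : ℕ) : ℝ) ≠ 0 := by positivity
  -- the weight: `|x − x′|/L^k ≤ |blk x − y| + |y − y′| + |blk x′ − y′| + 1`
  have hnR : ((((ℓ + 1) ^ k : ℕ)) : ℝ) = sc ℓ k j * ((bj ℓ j : ℕ) : ℝ) := by
    rw [sc_mul_bj (by omega : j ≤ k)]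
    push_cast
    ring
  have hn0 : (0 : ℝ) < (((ℓ + 1) ^ k : ℕ) : ℝ) := by positivity
  have hwt : ∀ (x' : ↥(boxDom (Nf ℓ k M))) (y y' : ↥(boxDom (Mj ℓ k M j))),
      δ₀ * supNorm (x.1 - x'.1) / (((ℓ + 1) ^ k : ℕ) : ℝ)
        ≤ δ₀ * (supNorm (blk (bj ℓ j) x.1 - y.1) + supNorm (y.1 - y'.1)
            + supNorm (blk (bj ℓ j) x'.1 - y'.1) + 1) := by
    intro x' y y'
    rw [mul_div_assoc]
    refine mul_le_mul_of_nonneg_left ?_ hδ0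
    rw [div_le_iff₀ hn0, hnR]
    have t1 := supNorm_sub_le_sub_add_sub (blk (bj ℓ j) x.1) y.1 (blk (bj ℓ j) x'.1)
    have t2 := supNorm_sub_le_sub_add_sub y.1 y'.1 (blk (bj ℓ j) x'.1)
    rw [show supNorm (y'.1 - blk (bj ℓ j) x'.1) = supNorm (blk (bj ℓ j) x'.1 - y'.1) from by
        rw [← B4TorusKernel.supNorm_neg, neg_sub]] at t2
    have hblk := supNorm_sub_le_blk hb1 x.1 x'.1
    have hp0 := supNorm_nonneg (blk (bj ℓ j) x.1 - y.1)
    have hq0 := supNorm_nonneg (y.1 - y'.1)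
    have hr0 := supNorm_nonneg (blk (bj ℓ j) x'.1 - y'.1)
    have hbR : (0 : ℝ) ≤ ((bj ℓ j : ℕ) : ℝ) := Nat.cast_nonneg _
    have hsc1 := one_le_sc ℓ k j
    have h5 : supNorm (x.1 - x'.1) ≤ ((bj ℓ j : ℕ) : ℝ) * (supNorm (blk (bj ℓ j) x.1 - y.1)
        + supNorm (y.1 - y'.1) + supNorm (blk (bj ℓ j) x'.1 - y'.1) + 1) :=
      hblk.trans (mul_le_mul_of_nonneg_left (by linarith) hbR)
    have h6 : 0 ≤ ((bj ℓ j : ℕ) : ℝ) * (supNorm (blk (bj ℓ j) x.1 - y.1)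
        + supNorm (y.1 - y'.1) + supNorm (blk (bj ℓ j) x'.1 - y'.1) + 1) :=
      mul_nonneg hbR (by linarith)
    calc supNorm (x.1 - x'.1) ≤ ((bj ℓ j : ℕ) : ℝ) * (supNorm (blk (bj ℓ j) x.1 - y.1)
          + supNorm (y.1 - y'.1) + supNorm (blk (bj ℓ j) x'.1 - y'.1) + 1) := h5
      _ = 1 * (((bj ℓ j : ℕ) : ℝ) * (supNorm (blk (bj ℓ j) x.1 - y.1)
          + supNorm (y.1 - y'.1) + supNorm (blk (bj ℓ j) x'.1 - y'.1) + 1)) := (one_mul _).symm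
      _ ≤ sc ℓ k j * (((bj ℓ j : ℕ) : ℝ) * (supNorm (blk (bj ℓ j) x.1 - y.1)
          + supNorm (y.1 - y'.1) + supNorm (blk (bj ℓ j) x'.1 - y'.1) + 1)) :=
        mul_le_mul_of_nonneg_right hsc1 h6
      _ = _ := by ring
  -- the per-term estimate
  have hterm : ∀ (x' : ↥(boxDom (Nf ℓ k M))) (y y' : ↥(boxDom (Mj ℓ k M j))),
      |g y| * |C y y'| * |B y' x'| * Real.exp (δ₀ * supNorm (x.1 - x'.1) / (((ℓ + 1) ^ k : ℕ) : ℝ))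
        ≤ (cA * cC * (((((bj ℓ j : ℕ) : ℝ)) ^ (d + 1))⁻¹ * cB)) * Real.exp δ₀
          * (Real.exp (-(κ / 2 * supNorm (blk (bj ℓ j) x.1 - y.1)))
              * Real.exp (-(δ / 2 * supNorm (y.1 - y'.1)))
              * Real.exp (-(κ / 2 * supNorm (blk (bj ℓ j) x'.1 - y'.1)))) := by
    intro x' y y'
    have e1 := hg y
    have e2 := hC y y'
    have e3 := hB y' x'
    have n1 : 0 ≤ cA * Real.exp (-(κ * supNorm (blk (bj ℓ j) x.1 - y.1))) :=
      mul_nonneg hcA (Real.exp_pos _).le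
    have n2 : 0 ≤ cC * Real.exp (-(δ * supNorm (y.1 - y'.1))) := mul_nonneg hcC (Real.exp_pos _).le
    have n3 : 0 ≤ ((((bj ℓ j : ℕ) : ℝ)) ^ (d + 1))⁻¹ *
        (cB * Real.exp (-(κ * supNorm (blk (bj ℓ j) x'.1 - y'.1)))) :=
      mul_nonneg (inv_pos.2 hbD).le (mul_nonneg hcB (Real.exp_pos _).le)
    have hprod := mul_le_mul (mul_le_mul e1 e2 (abs_nonneg _) n1) e3 (abs_nonneg _) (mul_nonneg n1 n2)
    have hm := exp_merge (supNorm_nonneg (blk (bj ℓ j) x.1 - y.1)) (supNorm_nonneg (y.1 - y'.1))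
      (supNorm_nonneg (blk (bj ℓ j) x'.1 - y'.1)) hδκ hδδ (hwt x' y y')
    have hP0 : 0 ≤ cA * cC * (((((bj ℓ j : ℕ) : ℝ)) ^ (d + 1))⁻¹ * cB) :=
      mul_nonneg (mul_nonneg hcA hcC) (mul_nonneg (inv_pos.2 hbD).le hcB)
    calc |g y| * |C y y'| * |B y' x'| * Real.exp (δ₀ * supNorm (x.1 - x'.1) / (((ℓ + 1) ^ k : ℕ) : ℝ))
        ≤ (cA * Real.exp (-(κ * supNorm (blk (bj ℓ j) x.1 - y.1)))
            * (cC * Real.exp (-(δ * supNorm (y.1 - y'.1))))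
            * (((((bj ℓ j : ℕ) : ℝ)) ^ (d + 1))⁻¹ *
                (cB * Real.exp (-(κ * supNorm (blk (bj ℓ j) x'.1 - y'.1))))))
            * Real.exp (δ₀ * supNorm (x.1 - x'.1) / (((ℓ + 1) ^ k : ℕ) : ℝ)) :=
          mul_le_mul_of_nonneg_right hprod (Real.exp_pos _).le
      _ = (cA * cC * (((((bj ℓ j : ℕ) : ℝ)) ^ (d + 1))⁻¹ * cB))
            * (Real.exp (δ₀ * supNorm (x.1 - x'.1) / (((ℓ + 1) ^ k : ℕ) : ℝ))
              * (Real.exp (-(κ * supNorm (blk (bj ℓ j) x.1 - y.1)))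
                  * Real.exp (-(δ * supNorm (y.1 - y'.1)))
                  * Real.exp (-(κ * supNorm (blk (bj ℓ j) x'.1 - y'.1))))) := by ring
      _ ≤ (cA * cC * (((((bj ℓ j : ℕ) : ℝ)) ^ (d + 1))⁻¹ * cB))
            * (Real.exp δ₀ * (Real.exp (-(κ / 2 * supNorm (blk (bj ℓ j) x.1 - y.1)))
              * Real.exp (-(δ / 2 * supNorm (y.1 - y'.1)))
              * Real.exp (-(κ / 2 * supNorm (blk (bj ℓ j) x'.1 - y'.1))))) :=
          mul_le_mul_of_nonneg_left hm hP0
      _ = _ := by ring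
  -- the three geometric sums
  have hF := rho_sumBound (Mj ℓ k M j) (κ / 2) (half_pos hκ) ⟨blk (bj ℓ j) x.1, blk_bj_mem hj M x⟩
  unfold wsum
  calc ∑ x', |∑ y', ∑ y, g y * C y y' * B y' x'|
          * Real.exp (δ₀ * supNorm (x.1 - x'.1) / (((ℓ + 1) ^ k : ℕ) : ℝ))
      ≤ ∑ x', (∑ y', ∑ y, |g y| * |C y y'| * |B y' x'|)
          * Real.exp (δ₀ * supNorm (x.1 - x'.1) / (((ℓ + 1) ^ k : ℕ) : ℝ)) := by
        refine Finset.sum_le_sum fun x' _ => mul_le_mul_of_nonneg_right ?_ (Real.exp_pos _).le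
        refine (Finset.abs_sum_le_sum_abs _ _).trans (Finset.sum_le_sum fun y' _ => ?_)
        refine (Finset.abs_sum_le_sum_abs _ _).trans (Finset.sum_le_sum fun y _ => ?_)
        rw [abs_mul, abs_mul]
    _ = ∑ x', ∑ y', ∑ y, |g y| * |C y y'| * |B y' x'|
          * Real.exp (δ₀ * supNorm (x.1 - x'.1) / (((ℓ + 1) ^ k : ℕ) : ℝ)) := by
        refine Finset.sum_congr rfl fun x' _ => ?_
        rw [Finset.sum_mul]
        refine Finset.sum_congr rfl fun y' _ => ?_
        rw [Finset.sum_mul]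
    _ ≤ ∑ x' : ↥(boxDom (Nf ℓ k M)), ∑ y' : ↥(boxDom (Mj ℓ k M j)), ∑ y : ↥(boxDom (Mj ℓ k M j)),
          (cA * cC * (((((bj ℓ j : ℕ) : ℝ)) ^ (d + 1))⁻¹ * cB)) * Real.exp δ₀
          * (Real.exp (-(κ / 2 * supNorm (blk (bj ℓ j) x.1 - y.1)))
              * Real.exp (-(δ / 2 * supNorm (y.1 - y'.1)))
              * Real.exp (-(κ / 2 * supNorm (blk (bj ℓ j) x'.1 - y'.1)))) := by
        apply Finset.sum_le_sum
        intro x' _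
        apply Finset.sum_le_sum
        intro y' _
        apply Finset.sum_le_sum
        intro y _
        exact hterm x' y y'
    _ = (cA * cC * (((((bj ℓ j : ℕ) : ℝ)) ^ (d + 1))⁻¹ * cB)) * Real.exp δ₀
          * ∑ x' : ↥(boxDom (Nf ℓ k M)), ∑ y' : ↥(boxDom (Mj ℓ k M j)), ∑ y : ↥(boxDom (Mj ℓ k M j)),
              Real.exp (-(κ / 2 * supNorm (blk (bj ℓ j) x.1 - y.1)))
              * Real.exp (-(δ / 2 * supNorm (y.1 - y'.1)))
              * Real.exp (-(κ / 2 * supNorm (blk (bj ℓ j) x'.1 - y'.1))) := by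
        rw [Finset.mul_sum]
        refine Finset.sum_congr rfl fun x' _ => ?_
        rw [Finset.mul_sum]
        refine Finset.sum_congr rfl fun y' _ => ?_
        rw [Finset.mul_sum]
    _ ≤ (cA * cC * (((((bj ℓ j : ℕ) : ℝ)) ^ (d + 1))⁻¹ * cB)) * Real.exp δ₀
          * (latticeConst (d + 1) (κ / 2) * latticeConst (d + 1) (δ / 2)
              * (((bj ℓ j : ℕ) : ℝ) ^ (d + 1) * latticeConst (d + 1) (κ / 2))) := by
        refine mul_le_mul_of_nonneg_left ?_ (mul_nonneg ?_ (Real.exp_pos _).le)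
        · exact sum3_le (fun y : ↥(boxDom (Mj ℓ k M j)) =>
              Real.exp (-(κ / 2 * supNorm (blk (bj ℓ j) x.1 - y.1))))
            (fun y y' : ↥(boxDom (Mj ℓ k M j)) => Real.exp (-(δ / 2 * supNorm (y.1 - y'.1))))
            (fun (y' : ↥(boxDom (Mj ℓ k M j))) (x' : ↥(boxDom (Nf ℓ k M))) =>
              Real.exp (-(κ / 2 * supNorm (blk (bj ℓ j) x'.1 - y'.1))))
            (fun _ => (Real.exp_pos _).le) (fun _ _ => (Real.exp_pos _).le) hKδ (mul_nonneg hbD.le hKκ) hF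
            (fun y => rho_sumBound (Mj ℓ k M j) (δ / 2) (half_pos hδ) y)
            (fun y' => fibre_sum_le hj M (half_pos hκ) y')
        · exact mul_nonneg (mul_nonneg hcA hcC) (mul_nonneg (inv_pos.2 hbD).le hcB)
    _ = _ := by
        field_simp

end Triple

/-! ## §3 Transport of the block-row DERIVATIVE decay (2.35) to the fine box -/

/-- **DIFFERENCED BLOCK-ROW SUMS OF `𝒢_j` DECAY** — transport of the derivative half of (2.35),
`|(∂^{L^{-j}}_μG_j(□)Q_j^*)(x,y)| ≤ c₀e^{−δ₀|x−y|}` in block-row form (`B4TwoBox120.green_blockRowDiff_bound`, kernel-proved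
in `B4Green242Bridge`), to the fine box, with `L^k = s_jb_j`: for lattice neighbours `xe = x + e_μ`,
`|L^k·Σ_{x′ : blk_{b_j}x′ = y}(𝒢_j(xe,x′) − 𝒢_j(x,x′))| ≤ s_j^{-1}·C·e^{−κ|blk_{b_j}x − y|}`.
[cite: Balaban1983RegularityDecay, p. 582 Lemma 2.4 (2.35)] -/
theorem Gfine_blockRowDiff_bound (d ℓ : ℕ) (hℓ : 1 ≤ ℓ) (aminus aplus m2plus : ℝ) (ha : 0 < aminus) :
    ∃ κ C : ℝ, 0 < κ ∧ 0 ≤ C ∧ ∀ (k j : ℕ), 1 ≤ j → ∀ (hj : j + 1 ≤ k), ∀ (a m2 : ℝ), aminus ≤ a → a ≤ aplus →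
      0 ≤ m2 → m2 ≤ m2plus → ∀ (M : Fin (d + 1) → ℕ), (∀ i, 1 ≤ M i) →
        ∀ (μ : Fin (d + 1)) (x xe : ↥(boxDom (Nf ℓ k M))), xe.1 = x.1 + Pi.single μ 1 →
        ∀ (y : Fin (d + 1) → ℤ), y ∈ boxDom (Mj ℓ k M j) →
          |((((ℓ + 1) ^ k : ℕ)) : ℝ) * ∑ x' : ↥(boxDom (Nf ℓ k M)),
              (if blk (bj ℓ j) x'.1 = y then Gfine ℓ k M j a m2 xe x' - Gfine ℓ k M j a m2 x x' else 0)|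
            ≤ (sc ℓ k j)⁻¹ * C * Real.exp (-(κ * supNorm (blk (bj ℓ j) x.1 - y))) := by
  obtain ⟨κ, C, hκ, hC, h⟩ := B4TwoBox120.green_blockRowDiff_bound d (aminus * (1 - ((((ℓ : ℝ) + 1)) ^ 2)⁻¹))
    aplus m2plus (aminus'_pos hℓ ha)
  refine ⟨κ, C, hκ, hC, fun k j hj1 hj a m2 h1 h2 h3 h4 M hM μ x xe hxe y hy => ?_⟩
  have ha0 : 0 < a := lt_of_lt_of_le ha h1
  obtain ⟨hw1, hw2, hapos⟩ := aSeq_window hℓ ha h1 h2 hj1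
  have hs : 0 < sc ℓ k j ^ 2 := pow_pos (sc_pos ℓ k j) 2
  have hsc0 : sc ℓ k j ≠ 0 := (sc_pos ℓ k j).ne'
  have hm' : 0 ≤ m2 / sc ℓ k j ^ 2 := div_nonneg h3 hs.le
  have hm'' : m2 / sc ℓ k j ^ 2 ≤ m2plus := (div_le_self h3 (one_le_pow₀ (one_le_sc ℓ k j))).trans h4
  have hxe' : ((ej ℓ k M j hj).symm xe).1 = ((ej ℓ k M j hj).symm x).1 + Pi.single μ 1 := hxe
  have hrow := h (bj ℓ j) (bj_pos ℓ j) _ _ hw1 hw2 hm' hm'' (Mj ℓ k M j) (Mj_pos hM) μ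
    ((ej ℓ k M j hj).symm x) ((ej ℓ k M j hj).symm xe) hxe' y hy
  have hxv : ((ej ℓ k M j hj).symm x).1 = x.1 := rfl
  rw [hxv, abs_mul, Nat.abs_cast] at hrow
  have hsum : ∑ x' : ↥(boxDom (Nf ℓ k M)),
      (if blk (bj ℓ j) x'.1 = y then Gfine ℓ k M j a m2 xe x' - Gfine ℓ k M j a m2 x x' else 0)
      = (sc ℓ k j ^ 2)⁻¹ * ∑ z : ↥(boxDom (fun i => bj ℓ j * Mj ℓ k M j i)),
          (if blk (bj ℓ j) z.1 = y then
            (boxOpR (bj ℓ j) (B1.aSeq a ((ℓ : ℝ) + 1) j) (m2 / sc ℓ k j ^ 2) (Mj ℓ k M j))⁻¹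
              ((ej ℓ k M j hj).symm xe) z
            - (boxOpR (bj ℓ j) (B1.aSeq a ((ℓ : ℝ) + 1) j) (m2 / sc ℓ k j ^ 2) (Mj ℓ k M j))⁻¹
              ((ej ℓ k M j hj).symm x) z else 0) := by
    rw [sum_Nf_eq_sum_ej hj, Finset.mul_sum]
    refine Finset.sum_congr rfl fun z _ => ?_
    have hzv : (ej ℓ k M j hj z).1 = z.1 := rfl
    rw [hzv]
    split_ifs with hz
    · rw [Gfine_apply hℓ hj1 hj hM ha0 h3, Gfine_apply hℓ hj1 hj hM ha0 h3, Equiv.symm_apply_apply, mul_sub]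
    · rw [mul_zero]
  have hnR : ((((ℓ + 1) ^ k : ℕ)) : ℝ) = sc ℓ k j * ((bj ℓ j : ℕ) : ℝ) := by
    rw [sc_mul_bj (by omega : j ≤ k)]
    push_cast
    ring
  have heq : ∀ S : ℝ, (((ℓ + 1) ^ k : ℕ) : ℝ) * ((sc ℓ k j ^ 2)⁻¹ * S)
      = (sc ℓ k j)⁻¹ * (((bj ℓ j : ℕ) : ℝ) * S) := by
    intro S
    rw [hnR]
    field_simp
  rw [hsum, heq, abs_mul, abs_of_pos (inv_pos.2 (sc_pos ℓ k j)), abs_mul, Nat.abs_cast, mul_assoc]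
  exact mul_le_mul_of_nonneg_left hrow (inv_pos.2 (sc_pos ℓ k j)).le


/-! ## §4 The differenced fluctuation term of one renormalization step

With `A_j = 𝒢_jQ_j^*`, `B_j = Q_j𝒢_j`, `C_j = s_j^{-2}C^{(j)}(□)` and `𝒢_{j+1} − 𝒢_j = α_j²·A_jC_jB_j`
(`B4Thm110ZeroBox.Gfine_succ_sub`, the (2.34) recursion), the row-differenced and `L^k`-scaled term is
`α_j²·Σ_{y′,y} g(y)C_j(y,y′)B_j(y′,x′)` with `g(y) = L^k(A_j(xe,y) − A_j(x,y))`, `|g(y)| ≤ s_j^{-1}C′e^{−κ|blk x−y|}` (§3):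
ONE factor `s_j^{-2}` of the value estimate is replaced by `s_j^{-1}` — exactly the `(L^jη)^{1}` of [B4] (2.38)–(2.39)
at `α = 0` — and the step is still summable: `≤ Θe^{δ₀}·L^{-(k-j)}`. -/

section StepBound

variable {ℓ k j : ℕ} {M : Fin (d + 1) → ℕ} {a m2 : ℝ}

set_option maxHeartbeats 1600000 in
/-- **THE DIFFERENCED STEP BOUND**: there are `κ₀ > 0`, `Θ ≥ 0` (depending on `d, ℓ` and the window only) such that
for every weight rate `0 ≤ δ₀ ≤ κ₀`, every `1 ≤ j < k`, every point of the window, every box and every pair of lattice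
neighbours `xe = x + e_μ` of the fine box:
`Σ_{x′} L^k|(𝒢_{j+1} − 𝒢_j)(xe,x′) − (𝒢_{j+1} − 𝒢_j)(x,x′)|·e^{δ₀|x−x′|_∞/L^k} ≤ Θe^{δ₀}·L^{-(k-j)}`. [folklore] -/
theorem step_termD_bound (d ℓ : ℕ) (hℓ : 1 ≤ ℓ) (amin aplus m2plus : ℝ) (ha : 0 < amin) :
    ∃ κ₀ Θ : ℝ, 0 < κ₀ ∧ 0 ≤ Θ ∧ ∀ (δ₀ : ℝ), 0 ≤ δ₀ → δ₀ ≤ κ₀ →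
      ∀ (k j : ℕ), 1 ≤ j → ∀ (hj : j + 1 ≤ k), ∀ (a m2 : ℝ), amin ≤ a → a ≤ aplus → 0 ≤ m2 →
        m2 ≤ m2plus → ∀ (M : Fin (d + 1) → ℕ), (∀ i, 1 ≤ M i) →
        ∀ (μ : Fin (d + 1)) (x xe : ↥(boxDom (Nf ℓ k M))), xe.1 = x.1 + Pi.single μ 1 →
          wsum δ₀ ((ℓ + 1) ^ k) x (fun x' => (((ℓ + 1) ^ k : ℕ) : ℝ) *
              ((Gfine ℓ k M (j + 1) a m2 - Gfine ℓ k M j a m2) xe x'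
                - (Gfine ℓ k M (j + 1) a m2 - Gfine ℓ k M j a m2) x x'))
            ≤ Θ * Real.exp δ₀ * (sc ℓ k j)⁻¹ := by
  obtain ⟨κ, C₁, hκ, hC₁, hR⟩ := Gfine_blockRow_bound d ℓ hℓ amin aplus m2plus ha
  obtain ⟨κ', C', hκ', hC', hDf⟩ := Gfine_blockRowDiff_bound d ℓ hℓ amin aplus m2plus ha
  obtain ⟨δ, c₂, hδ, hc₂, hCov⟩ := cov237_box_decay d ℓ hℓ (amin * (1 - ((((ℓ : ℝ) + 1)) ^ 2)⁻¹)) aplus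
    m2plus amin aplus (aminus'_pos hℓ ha) ha
  have hK0 : ∀ t : ℝ, 0 < t → 0 ≤ latticeConst (d + 1) t := fun t ht => latticeConst_nonneg _ ht.le
  have hκ₁ : 0 < min κ κ' := lt_min hκ hκ'
  have hKκ := hK0 _ (half_pos hκ₁)
  have hKδ := hK0 _ (half_pos hδ)
  refine ⟨min (min κ κ') δ / 2, aplus ^ 2 * (C' * c₂ * C₁)
      * (latticeConst (d + 1) (min κ κ' / 2) * latticeConst (d + 1) (δ / 2)
          * latticeConst (d + 1) (min κ κ' / 2)),
    by positivity, ?_, ?_⟩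
  · exact mul_nonneg (mul_nonneg (sq_nonneg _) (mul_nonneg (mul_nonneg hC' hc₂.le) hC₁))
      (mul_nonneg (mul_nonneg hKκ hKδ) hKκ)
  intro δ₀ hδ0 hδ1 k j hj1 hj a m2 h1 h2 h3 h4 M hM μ x xe hxe
  have ha0 : 0 < a := lt_of_lt_of_le ha h1
  obtain ⟨hw1, hw2, hapos⟩ := aSeq_window hℓ ha h1 h2 hj1
  have hs : 0 < sc ℓ k j ^ 2 := pow_pos (sc_pos ℓ k j) 2
  have hsi : 0 < (sc ℓ k j ^ 2)⁻¹ := inv_pos.2 hs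
  have hs1i : 0 < (sc ℓ k j)⁻¹ := inv_pos.2 (sc_pos ℓ k j)
  have hsc0 : sc ℓ k j ≠ 0 := (sc_pos ℓ k j).ne'
  have hm' : 0 ≤ m2 / sc ℓ k j ^ 2 := div_nonneg h3 hs.le
  have hm'' : m2 / sc ℓ k j ^ 2 ≤ m2plus :=
    (div_le_self h3 (one_le_pow₀ (one_le_sc ℓ k j))).trans h4
  have hb1 : 1 ≤ bj ℓ j := bj_pos ℓ j
  have hbD : (0 : ℝ) < ((bj ℓ j : ℕ) : ℝ) ^ (d + 1) := by positivity
  have hδκ : δ₀ ≤ min κ κ' / 2 := hδ1.trans (by linarith [min_le_left (min κ κ') δ])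
  have hδδ : δ₀ ≤ δ / 2 := hδ1.trans (by linarith [min_le_right (min κ κ') δ])
  -- the differenced block-row vector `g(y) = L^k(A_j(xe,y) − A_j(x,y))`
  have hg : ∀ y : ↥(boxDom (Mj ℓ k M j)),
      |(((ℓ + 1) ^ k : ℕ) : ℝ) * (Amat ℓ k M j a m2 xe y - Amat ℓ k M j a m2 x y)|
        ≤ (sc ℓ k j)⁻¹ * C' * Real.exp (-(min κ κ' * supNorm (blk (bj ℓ j) x.1 - y.1))) := by
    intro y
    have hAd : Amat ℓ k M j a m2 xe y - Amat ℓ k M j a m2 x y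
        = ∑ x', (if blk (bj ℓ j) x'.1 = y.1 then
            Gfine ℓ k M j a m2 xe x' - Gfine ℓ k M j a m2 x x' else 0) := by
      simp only [Amat, Matrix.mul_apply, QksM, Matrix.of_apply, mul_ite, mul_one, mul_zero]
      rw [← Finset.sum_sub_distrib]
      refine Finset.sum_congr rfl fun x' _ => ?_
      split_ifs <;> ring
    rw [hAd]
    exact (hDf k j hj1 hj a m2 h1 h2 h3 h4 M hM μ x xe hxe y.1 y.2).trans
      (mul_le_mul_of_nonneg_left (exp_rate_mono (min_le_right κ κ') (supNorm_nonneg _))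
        (mul_nonneg hs1i.le hC'))
  have hB : ∀ (y' : ↥(boxDom (Mj ℓ k M j))) (x' : ↥(boxDom (Nf ℓ k M))),
      |Bmat ℓ k M j a m2 y' x'| ≤ ((((bj ℓ j : ℕ) : ℝ)) ^ (d + 1))⁻¹ *
        ((sc ℓ k j ^ 2)⁻¹ * C₁ * Real.exp (-(min κ κ' * supNorm (blk (bj ℓ j) x'.1 - y'.1)))) := by
    intro y' x'
    have hBe : Bmat ℓ k M j a m2 y' x' = ((((bj ℓ j : ℕ) : ℝ)) ^ (d + 1))⁻¹ *
        ∑ w, (if blk (bj ℓ j) w.1 = y'.1 then Gfine ℓ k M j a m2 x' w else 0) := by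
      simp only [Bmat, Matrix.mul_apply, QkM, Matrix.of_apply, Finset.mul_sum]
      refine Finset.sum_congr rfl fun w _ => ?_
      split_ifs with hw
      · rw [(Gfine_isSymm ℓ k M j a m2).apply x' w]
      · rw [zero_mul, mul_zero]
    rw [hBe, abs_mul, abs_of_pos (inv_pos.2 hbD)]
    refine mul_le_mul_of_nonneg_left ?_ (inv_pos.2 hbD).le
    exact (hR k j hj1 hj a m2 h1 h2 h3 h4 M hM x' y'.1 y'.2).trans
      (mul_le_mul_of_nonneg_left (exp_rate_mono (min_le_left κ κ') (supNorm_nonneg _))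
        (mul_nonneg hsi.le hC₁))
  have hC : ∀ (y y' : ↥(boxDom (Mj ℓ k M j))),
      |Cmat ℓ k M j a m2 y y'| ≤ (sc ℓ k j ^ 2)⁻¹ * c₂ * Real.exp (-(δ * supNorm (y.1 - y'.1))) := by
    intro y y'
    have h := (hCov (bj ℓ j) hb1 _ _ a hw1 hw2 hm' hm'' h1 h2 (Mp ℓ k M j) (Mp_pos hM)).2 y y'
    rw [Cmat, Matrix.smul_apply, smul_eq_mul, abs_mul, abs_of_pos hsi, mul_assoc]
    exact mul_le_mul_of_nonneg_left h hsi.le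
  -- the triple-product estimate of §2
  have htri := wsum_gCB_le hj M x
    (fun y => (((ℓ + 1) ^ k : ℕ) : ℝ) * (Amat ℓ k M j a m2 xe y - Amat ℓ k M j a m2 x y))
    (Cmat ℓ k M j a m2) (Bmat ℓ k M j a m2)
    (mul_nonneg hs1i.le hC') (mul_nonneg hsi.le hc₂.le) (mul_nonneg hsi.le hC₁) hκ₁ hδ hδ0 hδκ hδδ hg hC hB
  -- `L^k·(differenced row of α_j²A_jC_jB_j) = α_j²·Σ_{y′,y} g C_j B_j`
  have hfun : (fun x' => (((ℓ + 1) ^ k : ℕ) : ℝ) *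
        ((Gfine ℓ k M (j + 1) a m2 - Gfine ℓ k M j a m2) xe x'
          - (Gfine ℓ k M (j + 1) a m2 - Gfine ℓ k M j a m2) x x'))
      = fun x' => αj a ℓ k j ^ 2 * ∑ y', ∑ y,
          (((ℓ + 1) ^ k : ℕ) : ℝ) * (Amat ℓ k M j a m2 xe y - Amat ℓ k M j a m2 x y)
            * Cmat ℓ k M j a m2 y y' * Bmat ℓ k M j a m2 y' x' := by
    funext x'
    rw [Gfine_succ_sub hℓ hj1 hj hM ha0 h3, Matrix.smul_apply, Matrix.smul_apply, smul_eq_mul, smul_eq_mul,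
      ← mul_sub, mul_left_comm, mul3_row_sub]
  have hα : αj a ℓ k j ^ 2 ≤ aplus ^ 2 * (sc ℓ k j ^ 2) ^ 2 := by
    unfold αj
    rw [mul_pow]
    exact mul_le_mul_of_nonneg_right (pow_le_pow_left₀ hapos.le hw2 2) (by positivity)
  rw [hfun, wsum_mul_left _ _ _ (sq_nonneg _)]
  calc αj a ℓ k j ^ 2 * wsum δ₀ ((ℓ + 1) ^ k) x (fun x' => ∑ y', ∑ y,
          (((ℓ + 1) ^ k : ℕ) : ℝ) * (Amat ℓ k M j a m2 xe y - Amat ℓ k M j a m2 x y)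
            * Cmat ℓ k M j a m2 y y' * Bmat ℓ k M j a m2 y' x')
      ≤ (aplus ^ 2 * (sc ℓ k j ^ 2) ^ 2) *
          ((sc ℓ k j)⁻¹ * C' * ((sc ℓ k j ^ 2)⁻¹ * c₂) * ((sc ℓ k j ^ 2)⁻¹ * C₁) * Real.exp δ₀
          * (latticeConst (d + 1) (min κ κ' / 2) * latticeConst (d + 1) (δ / 2)
              * latticeConst (d + 1) (min κ κ' / 2))) :=
        mul_le_mul hα htri (wsum_nonneg _ _ _ _) (by positivity)
    _ = aplus ^ 2 * (C' * c₂ * C₁)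
          * (latticeConst (d + 1) (min κ κ' / 2) * latticeConst (d + 1) (δ / 2)
              * latticeConst (d + 1) (min κ κ' / 2))
          * Real.exp δ₀ * (sc ℓ k j)⁻¹ := by
        field_simp

end StepBound

/-! ## §5 The induction over `j`: `Σ_{x′}L^k|𝒢_j(xe,x′) − 𝒢_j(x,x′)|e^{δ₀|x−x′|/L^k} ≤ B + Θe^{δ₀}Σ_{i<j}L^{-(k-i)}` -/

/-- `L^{-(k-j)} = L^{-1}·L^{-(k-j-1)}`. [folklore] -/
theorem sc_inv_succ {ℓ k j : ℕ} (hj : j + 1 ≤ k) :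
    (sc ℓ k j)⁻¹ = (((ℓ : ℝ) + 1))⁻¹ * (sc ℓ k (j + 1))⁻¹ := by
  rw [sc_eq_succ hj, mul_inv]

/-- `L^k·s_1^{-2} ≤ L` (`k ≥ 1`; `s_1 = L^{k-1}`): the base propagator `𝒢_1 = s_1^{-2}G_1(□)` loses at most one
power of `L` under the fine difference quotient `L^k·∇`. [folklore] -/
theorem Lk_mul_sc_one_sq_inv_le {ℓ k : ℕ} (hk : 1 ≤ k) :
    (((ℓ + 1) ^ k : ℕ) : ℝ) * (sc ℓ k 1 ^ 2)⁻¹ ≤ (ℓ : ℝ) + 1 := by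
  have hL0 : (0 : ℝ) < (ℓ : ℝ) + 1 := by positivity
  have hL : (1 : ℝ) ≤ (ℓ : ℝ) + 1 := by linarith [(Nat.cast_nonneg ℓ : (0 : ℝ) ≤ ℓ)]
  obtain ⟨k', rfl⟩ : ∃ k', k = k' + 1 := ⟨k - 1, by omega⟩
  have hsc : sc ℓ (k' + 1) 1 = ((ℓ : ℝ) + 1) ^ k' := by simp [sc]
  rw [hsc]
  push_cast
  rw [pow_succ]
  have hp : (0 : ℝ) < ((ℓ : ℝ) + 1) ^ k' := by positivity
  have hp1 : (1 : ℝ) ≤ ((ℓ : ℝ) + 1) ^ k' := one_le_pow₀ hL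
  rw [← div_eq_mul_inv, div_le_iff₀ (pow_pos hp 2)]
  nlinarith [mul_nonneg (mul_nonneg hL0.le hp.le) (sub_nonneg.2 hp1)]

set_option maxHeartbeats 800000 in
/-- **UNIFORM WEIGHTED BOUND FOR THE DIFFERENCED ROWS OF ALL THE PROPAGATORS `𝒢_j`, `1 ≤ j ≤ k`**: there are
`δ₀ > 0`, `c₀ > 0` (depending on `d, ℓ` and the window only) with
`Σ_{x′}L^k|𝒢_j(x+e_μ,x′) − 𝒢_j(x,x′)|e^{δ₀|x−x′|_∞/L^k} ≤ c₀` for every box, every `k ≥ 1`, every `1 ≤ j ≤ k`, every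
axis `μ` and every pair of neighbours `x, x+e_μ` of the fine box — induction over `j` from the base (the one-step box
Green's function of `B4Thm110ZeroBox` §7, differenced crudely: `|∇| ≤ 2` entries, `L^k·s_1^{-2} ≤ L`) with the summable
steps of §4 (`Σ_jL^{-(k-j)} ≤ L^{-1}/(1 − L^{-1}) ≤ 1`). [folklore] -/
theorem Gfine_rowwD_bound (d ℓ : ℕ) (hℓ : 1 ≤ ℓ) (amin aplus m2plus : ℝ) (ha : 0 < amin) :
    ∃ δ₀ c₀ : ℝ, 0 < δ₀ ∧ 0 < c₀ ∧ ∀ (k : ℕ), 1 ≤ k → ∀ (j : ℕ), 1 ≤ j → j ≤ k →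
      ∀ (a m2 : ℝ), amin ≤ a → a ≤ aplus → 0 ≤ m2 → m2 ≤ m2plus → ∀ (M : Fin (d + 1) → ℕ),
        (∀ i, 1 ≤ M i) → ∀ (μ : Fin (d + 1)) (x xe : ↥(boxDom (Nf ℓ k M))), xe.1 = x.1 + Pi.single μ 1 →
          wsum δ₀ ((ℓ + 1) ^ k) x (fun x' => (((ℓ + 1) ^ k : ℕ) : ℝ) *
              (Gfine ℓ k M j a m2 xe x' - Gfine ℓ k M j a m2 x x')) ≤ c₀ := by
  obtain ⟨r, C₀, hr, hC₀, hdec⟩ := boxOpR_L_inv_decay d ℓ hℓ (amin * (1 - ((((ℓ : ℝ) + 1)) ^ 2)⁻¹))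
    aplus m2plus (aminus'_pos hℓ ha)
  obtain ⟨κ₀, Θ, hκ₀, hΘ, hstep⟩ := step_termD_bound d ℓ hℓ amin aplus m2plus ha
  set δ₀ : ℝ := min (r / 2) κ₀ with hδ₀
  have hδ0 : 0 < δ₀ := lt_min (half_pos hr) hκ₀
  have hδr : δ₀ ≤ r / 2 := min_le_left _ _
  have hδκ : δ₀ ≤ κ₀ := min_le_right _ _
  have hK1 := one_le_latticeConst d (half_pos hr)
  have hL0 : (0 : ℝ) < (ℓ : ℝ) + 1 := by positivity
  set B₁ : ℝ := ((ℓ : ℝ) + 1) * C₀ * (Real.exp r + 1) * latticeConst (d + 1) (r / 2) with hB₁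
  have hB₁0 : 0 < B₁ := by positivity
  refine ⟨δ₀, B₁ + Θ * Real.exp δ₀, hδ0, by positivity, ?_⟩
  intro k hk j hj1 hjk a m2 h1 h2 h3 h4 M hM
  have ha0 : 0 < a := lt_of_lt_of_le ha h1
  have hL := one_lt_L_real hℓ
  set q : ℝ := (((ℓ : ℝ) + 1))⁻¹ with hq
  have hL2 : (2 : ℝ) ≤ (ℓ : ℝ) + 1 := by
    have : (1 : ℝ) ≤ ℓ := by exact_mod_cast hℓ
    linarith
  have hq0 : 0 < q := by positivity
  have hq2 : q ≤ 1 / 2 := by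
    rw [hq]
    calc (((ℓ : ℝ) + 1))⁻¹ ≤ (2 : ℝ)⁻¹ := inv_anti₀ (by norm_num) hL2
      _ = 1 / 2 := by norm_num
  have hq1 : 0 < 1 - q := by linarith
  have hnk : 1 ≤ (ℓ + 1) ^ k := Nat.one_le_pow _ _ (by omega)
  have hn0 : (0 : ℝ) ≤ (((ℓ + 1) ^ k : ℕ) : ℝ) := Nat.cast_nonneg _
  -- the base: entries of `𝒢_1`, scaled by `L^k`
  obtain ⟨hw1, hw2, hapos⟩ := aSeq_window hℓ ha h1 h2 (le_refl 1)
  have hT : ∀ p q' : ↥(boxDom (Nf ℓ k M)),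
      (((ℓ + 1) ^ k : ℕ) : ℝ) * |Gfine ℓ k M 1 a m2 p q'|
        ≤ ((ℓ : ℝ) + 1) * C₀ * Real.exp (-(r * supNorm (p.1 - q'.1))) := by
    intro p q'
    rcases Nat.lt_or_ge k 2 with hk2 | hk2
    · obtain rfl : k = 1 := by omega
      have hG : Gfine ℓ 1 M 1 a m2 = (boxOpR ((ℓ + 1) ^ 1) (B1.aSeq a ((ℓ : ℝ) + 1) 1) m2 M)⁻¹ := by
        unfold Gfine
        rw [fineOp_top]
      rw [hG]
      have hd := hdec ((ℓ + 1) ^ 1) (pow_one _) _ _ hw1 hw2 h3 h4 M p q'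
      have hc1 : (((ℓ + 1) ^ 1 : ℕ) : ℝ) = (ℓ : ℝ) + 1 := by push_cast; ring
      rw [hc1, mul_assoc]
      exact mul_le_mul_of_nonneg_left hd hL0.le
    · have hs : 0 < sc ℓ k 1 ^ 2 := pow_pos (sc_pos ℓ k 1) 2
      have hm' : 0 ≤ m2 / sc ℓ k 1 ^ 2 := div_nonneg h3 hs.le
      have hm'' : m2 / sc ℓ k 1 ^ 2 ≤ m2plus :=
        (div_le_self h3 (one_le_pow₀ (one_le_sc ℓ k 1))).trans h4
      rw [Gfine_apply hℓ (le_refl 1) hk2 hM ha0 h3 p q', abs_mul, abs_of_pos (inv_pos.2 hs), ← mul_assoc]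
      have hd := hdec (bj ℓ 1) (pow_one _) _ _ hw1 hw2 hm' hm'' (Mj ℓ k M 1)
        ((ej ℓ k M 1 hk2).symm p) ((ej ℓ k M 1 hk2).symm q')
      calc (((ℓ + 1) ^ k : ℕ) : ℝ) * (sc ℓ k 1 ^ 2)⁻¹ *
            |(boxOpR (bj ℓ 1) (B1.aSeq a ((ℓ : ℝ) + 1) 1) (m2 / sc ℓ k 1 ^ 2)
              (Mj ℓ k M 1))⁻¹ ((ej ℓ k M 1 hk2).symm p) ((ej ℓ k M 1 hk2).symm q')|
          ≤ ((ℓ : ℝ) + 1) * (C₀ * Real.exp (-(r * supNorm (p.1 - q'.1)))) :=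
            mul_le_mul (Lk_mul_sc_one_sq_inv_le hk) hd (abs_nonneg _) hL0.le
        _ = _ := by ring
  -- the base: the differenced rows
  have hTD : ∀ (μ : Fin (d + 1)) (x xe : ↥(boxDom (Nf ℓ k M))), xe.1 = x.1 + Pi.single μ 1 →
      ∀ x', |(((ℓ + 1) ^ k : ℕ) : ℝ) * (Gfine ℓ k M 1 a m2 xe x' - Gfine ℓ k M 1 a m2 x x')|
        ≤ ((ℓ : ℝ) + 1) * C₀ * (Real.exp r + 1) * Real.exp (-(r * supNorm (x.1 - x'.1))) := by
    intro μ x xe hxe x'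
    have h1' := hT xe x'
    have h2' := hT x x'
    have hnb := supNorm_sub_le_nbr (x' := x'.1) hxe
    have he : Real.exp (-(r * supNorm (xe.1 - x'.1))) ≤ Real.exp r * Real.exp (-(r * supNorm (x.1 - x'.1))) := by
      rw [← Real.exp_add]
      exact Real.exp_le_exp.2 (by nlinarith)
    have hLC : 0 ≤ ((ℓ : ℝ) + 1) * C₀ := by positivity
    calc |(((ℓ + 1) ^ k : ℕ) : ℝ) * (Gfine ℓ k M 1 a m2 xe x' - Gfine ℓ k M 1 a m2 x x')|
        = (((ℓ + 1) ^ k : ℕ) : ℝ) * |Gfine ℓ k M 1 a m2 xe x' - Gfine ℓ k M 1 a m2 x x'| := by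
          rw [abs_mul, abs_of_nonneg hn0]
      _ ≤ (((ℓ + 1) ^ k : ℕ) : ℝ) * (|Gfine ℓ k M 1 a m2 xe x'| + |Gfine ℓ k M 1 a m2 x x'|) :=
          mul_le_mul_of_nonneg_left (abs_sub _ _) hn0
      _ = (((ℓ + 1) ^ k : ℕ) : ℝ) * |Gfine ℓ k M 1 a m2 xe x'|
            + (((ℓ + 1) ^ k : ℕ) : ℝ) * |Gfine ℓ k M 1 a m2 x x'| := mul_add _ _ _
      _ ≤ ((ℓ : ℝ) + 1) * C₀ * Real.exp (-(r * supNorm (xe.1 - x'.1)))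
            + ((ℓ : ℝ) + 1) * C₀ * Real.exp (-(r * supNorm (x.1 - x'.1))) := add_le_add h1' h2'
      _ ≤ ((ℓ : ℝ) + 1) * C₀ * (Real.exp r * Real.exp (-(r * supNorm (x.1 - x'.1))))
            + ((ℓ : ℝ) + 1) * C₀ * Real.exp (-(r * supNorm (x.1 - x'.1))) :=
          add_le_add (mul_le_mul_of_nonneg_left he hLC) le_rfl
      _ = _ := by ring
  -- the inductive claim
  have main : ∀ j, 1 ≤ j → j ≤ k → ∀ (μ : Fin (d + 1)) (x xe : ↥(boxDom (Nf ℓ k M))),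
      xe.1 = x.1 + Pi.single μ 1 →
      wsum δ₀ ((ℓ + 1) ^ k) x (fun x' => (((ℓ + 1) ^ k : ℕ) : ℝ) *
          (Gfine ℓ k M j a m2 xe x' - Gfine ℓ k M j a m2 x x'))
        ≤ B₁ + Θ * Real.exp δ₀ * (q * (sc ℓ k j)⁻¹ / (1 - q)) := by
    intro j hj1
    induction j, hj1 using Nat.le_induction with
    | base =>
      intro _ μ x xe hxe
      have hB0 : 0 ≤ ((ℓ : ℝ) + 1) * C₀ * (Real.exp r + 1) := by positivity
      calc wsum δ₀ ((ℓ + 1) ^ k) x (fun x' => (((ℓ + 1) ^ k : ℕ) : ℝ) *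
              (Gfine ℓ k M 1 a m2 xe x' - Gfine ℓ k M 1 a m2 x x'))
          ≤ ((ℓ : ℝ) + 1) * C₀ * (Real.exp r + 1) * latticeConst (d + 1) (r / 2) :=
            wsum_le_of_decay hnk x hB0 hr hδ0.le hδr (hTD μ x xe hxe)
        _ ≤ B₁ + Θ * Real.exp δ₀ * (q * (sc ℓ k 1)⁻¹ / (1 - q)) := by
            rw [hB₁]
            have : 0 ≤ Θ * Real.exp δ₀ * (q * (sc ℓ k 1)⁻¹ / (1 - q)) := by
              have := sc_pos ℓ k 1
              positivity
            linarith
    | succ j hj1 ih =>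
      intro hjk μ x xe hxe
      have hprev := ih (by omega) μ x xe hxe
      have hst := hstep δ₀ hδ0.le hδκ k j hj1 hjk a m2 h1 h2 h3 h4 M hM μ x xe hxe
      have hsplit : (fun x' => (((ℓ + 1) ^ k : ℕ) : ℝ) *
            (Gfine ℓ k M (j + 1) a m2 xe x' - Gfine ℓ k M (j + 1) a m2 x x'))
          = fun x' => (((ℓ + 1) ^ k : ℕ) : ℝ) *
              ((Gfine ℓ k M (j + 1) a m2 - Gfine ℓ k M j a m2) xe x'
                - (Gfine ℓ k M (j + 1) a m2 - Gfine ℓ k M j a m2) x x')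
            + (((ℓ + 1) ^ k : ℕ) : ℝ) * (Gfine ℓ k M j a m2 xe x' - Gfine ℓ k M j a m2 x x') := by
        funext x'
        simp only [Matrix.sub_apply]
        ring
      rw [hsplit]
      calc wsum δ₀ ((ℓ + 1) ^ k) x (fun x' => (((ℓ + 1) ^ k : ℕ) : ℝ) *
              ((Gfine ℓ k M (j + 1) a m2 - Gfine ℓ k M j a m2) xe x'
                - (Gfine ℓ k M (j + 1) a m2 - Gfine ℓ k M j a m2) x x')
            + (((ℓ + 1) ^ k : ℕ) : ℝ) * (Gfine ℓ k M j a m2 xe x' - Gfine ℓ k M j a m2 x x'))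
          ≤ wsum δ₀ ((ℓ + 1) ^ k) x (fun x' => (((ℓ + 1) ^ k : ℕ) : ℝ) *
              ((Gfine ℓ k M (j + 1) a m2 - Gfine ℓ k M j a m2) xe x'
                - (Gfine ℓ k M (j + 1) a m2 - Gfine ℓ k M j a m2) x x'))
            + wsum δ₀ ((ℓ + 1) ^ k) x (fun x' => (((ℓ + 1) ^ k : ℕ) : ℝ) *
              (Gfine ℓ k M j a m2 xe x' - Gfine ℓ k M j a m2 x x')) := wsum_add_le _ _ _ _ _
        _ ≤ Θ * Real.exp δ₀ * (sc ℓ k j)⁻¹ + (B₁ + Θ * Real.exp δ₀ * (q * (sc ℓ k j)⁻¹ / (1 - q))) :=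
            add_le_add hst hprev
        _ = B₁ + Θ * Real.exp δ₀ * (q * (sc ℓ k (j + 1))⁻¹ / (1 - q)) := by
            rw [sc_inv_succ hjk, ← hq]
            field_simp
            ring
  intro μ x xe hxe
  have hm := main j hj1 hjk μ x xe hxe
  have hs1 : (sc ℓ k j)⁻¹ ≤ 1 := inv_le_one_of_one_le₀ (one_le_sc ℓ k j)
  have hs0 : 0 < (sc ℓ k j)⁻¹ := inv_pos.2 (sc_pos ℓ k j)
  have hgeo : q * (sc ℓ k j)⁻¹ / (1 - q) ≤ 1 := by
    rw [div_le_one hq1]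
    calc q * (sc ℓ k j)⁻¹ ≤ q * 1 := mul_le_mul_of_nonneg_left hs1 hq0.le
      _ ≤ 1 - q := by linarith
  have hΘe : 0 ≤ Θ * Real.exp δ₀ := by positivity
  have hfin := mul_le_of_le_one_right hΘe hgeo
  linarith

/-! ## §6 THEOREM (1.10) of [B4], DERIVATIVE CLAUSE, at `A = 0` for boxes: the decay of `D^η_μG_k(□)` -/

/-- **[B4] p. 573 THEOREM, inequality (1.10), DERIVATIVE CLAUSE `|(D^η_{A,μ}G_k(Ω,A)f)(x)|`, at `A = 0`, for
rectangular parallelepipeds `Ω = □`** (weighted-row form, slightly stronger than the pointwise statement): there are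
`δ₀ > 0`, `c₀ > 0` depending only on `d`, `L = ℓ + 1` and the window such that for every `k ≥ 1` (`η = L^{-k}`), every
`(a, m²)` in the window, every box `□ = Π_μ[0, M_μ)` (`M_μ ≥ 1`), every axis `μ` and every pair of fine-lattice
neighbours `x, xe = x + ηe_μ` in `□`:
`Σ_{x′ ∈ □} |η^{-1}(G(□; x + ηe_μ, x′) − G(□; x, x′))|·e^{δ₀·dist(x,x′)} ≤ c₀`,
`G(□) = (−Δ^{η,N}_□ + m² + a_kP_k)^{-1}` the propagator (1.9) at `A = 0` in values form (`a ↤ a_k`, DICTIONARY in the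
header), `η^{-1}(φ(x + ηe_μ) − φ(x)) = (D^η_{0,μ}φ)(x)` the covariant derivative (1.3) at `A = 0` (`U ≡ 1`),
`dist = |·|_∞/L^k`.  HONEST LABEL: proved here by the print's box route (2.34)/(2.38)–(2.39) at `A = 0` over the
package's kernel theorems — not a transcription of the print's general proof of Proposition 2.1.
[cite: Balaban1983RegularityDecay, p. 573 Theorem (1.10); p. 582 (2.34)–(2.35), (2.38)–(2.39)] -/
theorem thm110_zero_box_deriv_roww (d ℓ : ℕ) (hℓ : 1 ≤ ℓ) (amin aplus m2plus : ℝ) (ha : 0 < amin) :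
    ∃ δ₀ c₀ : ℝ, 0 < δ₀ ∧ 0 < c₀ ∧ ∀ (k : ℕ), 1 ≤ k → ∀ (a m2 : ℝ), amin ≤ a → a ≤ aplus → 0 ≤ m2 →
      m2 ≤ m2plus → ∀ (M : Fin (d + 1) → ℕ), (∀ i, 1 ≤ M i) →
        ∀ (μ : Fin (d + 1)) (x xe : ↥(boxDom (fun i => (ℓ + 1) ^ k * M i))), xe.1 = x.1 + Pi.single μ 1 →
          ∑ x', |(((ℓ + 1) ^ k : ℕ) : ℝ) *
                ((boxOpR ((ℓ + 1) ^ k) (B1.aSeq a ((ℓ : ℝ) + 1) k) m2 M)⁻¹ xe x'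
                  - (boxOpR ((ℓ + 1) ^ k) (B1.aSeq a ((ℓ : ℝ) + 1) k) m2 M)⁻¹ x x')|
              * Real.exp (δ₀ * supNorm (x.1 - x'.1) / (((ℓ + 1) ^ k : ℕ) : ℝ)) ≤ c₀ := by
  obtain ⟨δ₀, c₀, hδ, hc, h⟩ := Gfine_rowwD_bound d ℓ hℓ amin aplus m2plus ha
  refine ⟨δ₀, c₀, hδ, hc, fun k hk a m2 h1 h2 h3 h4 M hM μ x xe hxe => ?_⟩
  have hG : Gfine ℓ k M k a m2 = (boxOpR ((ℓ + 1) ^ k) (B1.aSeq a ((ℓ : ℝ) + 1) k) m2 M)⁻¹ := by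
    unfold Gfine
    rw [fineOp_top]
  have := h k hk k hk le_rfl a m2 h1 h2 h3 h4 M hM μ x xe hxe
  rw [wsum, hG] at this
  exact this

/-! ## §7 The printed forms: the derivative clause of (1.10) with `‖f‖_∞` and `dist(x, supp f)`, and Lemma 2.2
(2.16)/(2.17) for `D^η_μG_k(□)` (`p = q = ∞`) and `G_k(□)D^{η*}_μ` (`p = q = 1`) at `A = 0` -/

section Corollaries

variable {N : Fin (d + 1) → ℕ}

/-- the difference quotient of `Tf` is the vector of differenced kernel rows applied to `f`:
`t((Tf)(xe) − (Tf)(x)) = Σ_{x′} t(T(xe,x′) − T(x,x′))f(x′)`. [folklore] -/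
theorem mulVec_sub_mulVec (T : Matrix ↥(boxDom N) ↥(boxDom N) ℝ) (f : ↥(boxDom N) → ℝ) (x xe : ↥(boxDom N))
    (t : ℝ) : t * ((T *ᵥ f) xe - (T *ᵥ f) x) = ∑ x', t * (T xe x' - T x x') * f x' := by
  simp only [Matrix.mulVec, dotProduct]
  rw [← Finset.sum_sub_distrib, Finset.mul_sum]
  refine Finset.sum_congr rfl fun x' _ => ?_
  ring

end Corollaries

/-- **THEOREM (1.10) OF [B4] AT `A = 0` FOR RECTANGULAR PARALLELEPIPEDS — THE PRINTED DERIVATIVE CLAUSE**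
`|(D^η_{0,μ}G_k(□)f)(x)| ≤ c₀ exp(−δ₀ dist(x, supp f))‖f‖_∞` for ALL `x ∈ □` with `x + ηe_μ ∈ □` («for rectangular
parallelepipeds, the inequalities hold without any restrictions on the points», p. 573): there are `δ₀ > 0`, `c₀ > 0`
depending only on `d`, `ℓ` and the window such that for every `k ≥ 1` (`η = L^{-k}`), `(a, m²)` in the window, every
box, every `f : □ ∩ ηℤ^{d+1} → ℝ`, every bound `F ≥ |f|`, every axis `μ`, every pair of neighbours `x, xe = x + ηe_μ`
and every `D` with `D ≤ |x − x′|_∞` for all `x′ ∈ supp f` (fine-lattice units, `ηD ≤ dist_∞(x, supp f)`):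
`|η^{-1}((Gf)(x + ηe_μ) − (Gf)(x))| ≤ c₀·e^{−δ₀ηD}·F`. [cite: Balaban1983RegularityDecay, Theorem (Prop. 2.1 of [1]) (1.10) p.573] -/
theorem thm110_zero_box_deriv_value (d ℓ : ℕ) (hℓ : 1 ≤ ℓ) (amin aplus m2plus : ℝ) (ha : 0 < amin) :
    ∃ δ₀ c₀ : ℝ, 0 < δ₀ ∧ 0 < c₀ ∧ ∀ (k : ℕ), 1 ≤ k → ∀ (a m2 : ℝ), amin ≤ a → a ≤ aplus → 0 ≤ m2 →
      m2 ≤ m2plus → ∀ (M : Fin (d + 1) → ℕ), (∀ i, 1 ≤ M i) →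
      ∀ (f : ↥(boxDom (fun i => (ℓ + 1) ^ k * M i)) → ℝ) (F D : ℝ), (∀ x', |f x'| ≤ F) →
      ∀ (μ : Fin (d + 1)) (x xe : ↥(boxDom (fun i => (ℓ + 1) ^ k * M i))), xe.1 = x.1 + Pi.single μ 1 →
        (∀ x', f x' ≠ 0 → D ≤ supNorm (x.1 - x'.1)) →
        |(((ℓ + 1) ^ k : ℕ) : ℝ) *
            (((boxOpR ((ℓ + 1) ^ k) (B1.aSeq a ((ℓ : ℝ) + 1) k) m2 M)⁻¹ *ᵥ f) xe
              - ((boxOpR ((ℓ + 1) ^ k) (B1.aSeq a ((ℓ : ℝ) + 1) k) m2 M)⁻¹ *ᵥ f) x)|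
          ≤ c₀ * Real.exp (-(δ₀ * D / (((ℓ + 1) ^ k : ℕ) : ℝ))) * F := by
  obtain ⟨δ₀, c₀, hδ0, hc0, h⟩ := thm110_zero_box_deriv_roww d ℓ hℓ amin aplus m2plus ha
  refine ⟨δ₀, c₀, hδ0, hc0, ?_⟩
  intro k hk a m2 h1 h2 h3 h4 M hM f F D hF μ x xe hxe hD
  rw [mulVec_sub_mulVec]
  exact abs_sum_mul_le_of_wsum hδ0.le _ x _ (h k hk a m2 h1 h2 h3 h4 M hM μ x xe hxe) f hF hD

/-- **THE SAME WITH THE LITERAL `dist(x, supp f)`** (`dsupp f x` of `B4Thm110ZeroBox` = the `ℓ^∞` distance from `x`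
to `supp f` in fine-lattice units): `|η^{-1}((Gf)(x+ηe_μ) − (Gf)(x))| ≤ c₀e^{−δ₀η·dsupp f x}·F` for every `F ≥ |f|`.
[cite: Balaban1983RegularityDecay, Theorem (Prop. 2.1 of [1]) (1.10) p.573] -/
theorem thm110_zero_box_deriv_dist (d ℓ : ℕ) (hℓ : 1 ≤ ℓ) (amin aplus m2plus : ℝ) (ha : 0 < amin) :
    ∃ δ₀ c₀ : ℝ, 0 < δ₀ ∧ 0 < c₀ ∧ ∀ (k : ℕ), 1 ≤ k → ∀ (a m2 : ℝ), amin ≤ a → a ≤ aplus → 0 ≤ m2 →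
      m2 ≤ m2plus → ∀ (M : Fin (d + 1) → ℕ), (∀ i, 1 ≤ M i) →
      ∀ (f : ↥(boxDom (fun i => (ℓ + 1) ^ k * M i)) → ℝ) (F : ℝ), (∀ x', |f x'| ≤ F) →
      ∀ (μ : Fin (d + 1)) (x xe : ↥(boxDom (fun i => (ℓ + 1) ^ k * M i))), xe.1 = x.1 + Pi.single μ 1 →
        |(((ℓ + 1) ^ k : ℕ) : ℝ) *
            (((boxOpR ((ℓ + 1) ^ k) (B1.aSeq a ((ℓ : ℝ) + 1) k) m2 M)⁻¹ *ᵥ f) xe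
              - ((boxOpR ((ℓ + 1) ^ k) (B1.aSeq a ((ℓ : ℝ) + 1) k) m2 M)⁻¹ *ᵥ f) x)|
          ≤ c₀ * Real.exp (-(δ₀ * dsupp f x / (((ℓ + 1) ^ k : ℕ) : ℝ))) * F := by
  obtain ⟨δ₀, c₀, hδ0, hc0, h⟩ := thm110_zero_box_deriv_value d ℓ hℓ amin aplus m2plus ha
  refine ⟨δ₀, c₀, hδ0, hc0, ?_⟩
  intro k hk a m2 h1 h2 h3 h4 M hM f F hF μ x xe hxe
  exact h k hk a m2 h1 h2 h3 h4 M hM f F (dsupp f x) hF μ x xe hxe fun x' hx' => dsupp_le f x x' hx'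

/-- **LEMMA 2.2 (2.16)/(2.17) AT `A = 0` FOR `D^η_μG_k(□)`, `p = q = ∞`** (the `sup|∂^η_μG_k(□)f|` part of (2.16),
p. 583 «We estimate in the same way |(G_k(□)f)(x)|, |(∂^η_μG_k(□)f)(x)|»): `‖D^η_μG_k(□)‖_{∞→∞} ≤ c₀`, i.e.
`Σ_{x′}|η^{-1}(G(x+ηe_μ,x′) − G(x,x′))| ≤ c₀` for every pair of neighbours, uniformly in `k ≥ 1`, the window and the box.
[cite: Balaban1983RegularityDecay, Lemma 2.2 (2.16)–(2.17) p.577–578; p.583] -/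
theorem lemma22_zero_box_deriv_rowSum (d ℓ : ℕ) (hℓ : 1 ≤ ℓ) (amin aplus m2plus : ℝ) (ha : 0 < amin) :
    ∃ c₀ : ℝ, 0 < c₀ ∧ ∀ (k : ℕ), 1 ≤ k → ∀ (a m2 : ℝ), amin ≤ a → a ≤ aplus → 0 ≤ m2 →
      m2 ≤ m2plus → ∀ (M : Fin (d + 1) → ℕ), (∀ i, 1 ≤ M i) →
      ∀ (μ : Fin (d + 1)) (x xe : ↥(boxDom (fun i => (ℓ + 1) ^ k * M i))), xe.1 = x.1 + Pi.single μ 1 →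
        ∑ x', |(((ℓ + 1) ^ k : ℕ) : ℝ) *
            ((boxOpR ((ℓ + 1) ^ k) (B1.aSeq a ((ℓ : ℝ) + 1) k) m2 M)⁻¹ xe x'
              - (boxOpR ((ℓ + 1) ^ k) (B1.aSeq a ((ℓ : ℝ) + 1) k) m2 M)⁻¹ x x')| ≤ c₀ := by
  obtain ⟨δ₀, c₀, hδ0, hc0, h⟩ := thm110_zero_box_deriv_roww d ℓ hℓ amin aplus m2plus ha
  refine ⟨c₀, hc0, ?_⟩
  intro k hk a m2 h1 h2 h3 h4 M hM μ x xe hxe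
  exact (sum_abs_le_wsum hδ0.le ((ℓ + 1) ^ k) x _).trans (h k hk a m2 h1 h2 h3 h4 M hM μ x xe hxe)

/-- **`‖D^η_μG_k(□)f‖_∞ ≤ c₀‖f‖_∞`** — (2.16)/(2.17) at `A = 0` for the derivative in the printed operator form
(`D = 0` in the value bound). [cite: Balaban1983RegularityDecay, Lemma 2.2 (2.16)–(2.17) p.577–578; p.583] -/
theorem lemma22_zero_box_deriv_sup (d ℓ : ℕ) (hℓ : 1 ≤ ℓ) (amin aplus m2plus : ℝ) (ha : 0 < amin) :
    ∃ c₀ : ℝ, 0 < c₀ ∧ ∀ (k : ℕ), 1 ≤ k → ∀ (a m2 : ℝ), amin ≤ a → a ≤ aplus → 0 ≤ m2 →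
      m2 ≤ m2plus → ∀ (M : Fin (d + 1) → ℕ), (∀ i, 1 ≤ M i) →
      ∀ (f : ↥(boxDom (fun i => (ℓ + 1) ^ k * M i)) → ℝ) (F : ℝ), (∀ x', |f x'| ≤ F) →
      ∀ (μ : Fin (d + 1)) (x xe : ↥(boxDom (fun i => (ℓ + 1) ^ k * M i))), xe.1 = x.1 + Pi.single μ 1 →
        |(((ℓ + 1) ^ k : ℕ) : ℝ) *
            (((boxOpR ((ℓ + 1) ^ k) (B1.aSeq a ((ℓ : ℝ) + 1) k) m2 M)⁻¹ *ᵥ f) xe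
              - ((boxOpR ((ℓ + 1) ^ k) (B1.aSeq a ((ℓ : ℝ) + 1) k) m2 M)⁻¹ *ᵥ f) x)| ≤ c₀ * F := by
  obtain ⟨δ₀, c₀, hδ0, hc0, h⟩ := thm110_zero_box_deriv_value d ℓ hℓ amin aplus m2plus ha
  refine ⟨c₀, hc0, ?_⟩
  intro k hk a m2 h1 h2 h3 h4 M hM f F hF μ x xe hxe
  have := h k hk a m2 h1 h2 h3 h4 M hM f F 0 hF μ x xe hxe fun x' _ => supNorm_nonneg _
  simpa using this

/-- **LEMMA 2.2 (2.17) AT `A = 0` FOR `G_k(□)D^{η*}_μ`, `p = q = 1`**: by the symmetry of `G` the kernel of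
`G_k(□)D^{η*}_μ`, `(x′, b) ↦ η^{-1}(G(x′, b₊) − G(x′, b₋))` over the `μ`-bonds `b = ⟨x, x + ηe_μ⟩` of `□`, is the transpose
of the kernel of `D^η_μG_k(□)`; its column sums are the row sums above: `Σ_{x′}|η^{-1}(G(x′,x+ηe_μ) − G(x′,x))| ≤ c₀`
for every bond, i.e. `‖G_k(□)D^{η*}_μ‖_{1→1} ≤ c₀` (p. 583: «For q = p = 1 we get it by duality argument»).
[cite: Balaban1983RegularityDecay, Lemma 2.2 (2.17) p.578; p.583] -/
theorem lemma22_zero_box_derivAdj_colSum (d ℓ : ℕ) (hℓ : 1 ≤ ℓ) (amin aplus m2plus : ℝ) (ha : 0 < amin) :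
    ∃ c₀ : ℝ, 0 < c₀ ∧ ∀ (k : ℕ), 1 ≤ k → ∀ (a m2 : ℝ), amin ≤ a → a ≤ aplus → 0 ≤ m2 →
      m2 ≤ m2plus → ∀ (M : Fin (d + 1) → ℕ), (∀ i, 1 ≤ M i) →
      ∀ (μ : Fin (d + 1)) (x xe : ↥(boxDom (fun i => (ℓ + 1) ^ k * M i))), xe.1 = x.1 + Pi.single μ 1 →
        ∑ x', |(((ℓ + 1) ^ k : ℕ) : ℝ) *
            ((boxOpR ((ℓ + 1) ^ k) (B1.aSeq a ((ℓ : ℝ) + 1) k) m2 M)⁻¹ x' xe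
              - (boxOpR ((ℓ + 1) ^ k) (B1.aSeq a ((ℓ : ℝ) + 1) k) m2 M)⁻¹ x' x)| ≤ c₀ := by
  obtain ⟨c₀, hc0, h⟩ := lemma22_zero_box_deriv_rowSum d ℓ hℓ amin aplus m2plus ha
  refine ⟨c₀, hc0, ?_⟩
  intro k hk a m2 h1 h2 h3 h4 M hM μ x xe hxe
  have hS := boxOpR_inv_isSymm ((ℓ + 1) ^ k) (B1.aSeq a ((ℓ : ℝ) + 1) k) m2 M
  have heq : ∀ x', (boxOpR ((ℓ + 1) ^ k) (B1.aSeq a ((ℓ : ℝ) + 1) k) m2 M)⁻¹ x' xe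
        - (boxOpR ((ℓ + 1) ^ k) (B1.aSeq a ((ℓ : ℝ) + 1) k) m2 M)⁻¹ x' x
      = (boxOpR ((ℓ + 1) ^ k) (B1.aSeq a ((ℓ : ℝ) + 1) k) m2 M)⁻¹ xe x'
        - (boxOpR ((ℓ + 1) ^ k) (B1.aSeq a ((ℓ : ℝ) + 1) k) m2 M)⁻¹ x x' := by
    intro x'
    rw [hS.apply xe x', hS.apply x x']
  simp_rw [heq]
  exact h k hk a m2 h1 h2 h3 h4 M hM μ x xe hxe

/-! ### The literal coefficient `a` of (1.6)

As in `B4Thm110ZeroBox` §11: B4 (1.6) carries a generic `a` «close to 1» where the RG equations of [1] carry the running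
`a_k = B1.aSeq a L k = a·c_k`, `c_k ∈ [1 − L^{-2}, 1]`; since `a ↦ a_k` is a linear bijection of `]0,∞[` the bounds hold
for the literal coefficient over any window `[a₋, a₊]`, with the constants of the window `[a₋, a₊/(1 − L^{-2})]`. -/

/-- **THE DERIVATIVE CLAUSE OF (1.10) AT `A = 0` FOR BOXES WITH THE LITERAL COEFFICIENT `a` OF (1.6)** (weighted-row
form). [cite: Balaban1983RegularityDecay, Theorem (Prop. 2.1 of [1]) (1.10) p.573 with (1.6) p.572] -/
theorem thm110_zero_box_deriv_roww_coeff (d ℓ : ℕ) (hℓ : 1 ≤ ℓ) (amin aplus m2plus : ℝ) (ha : 0 < amin) :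
    ∃ δ₀ c₀ : ℝ, 0 < δ₀ ∧ 0 < c₀ ∧ ∀ (k : ℕ), 1 ≤ k → ∀ (a m2 : ℝ), amin ≤ a → a ≤ aplus → 0 ≤ m2 →
      m2 ≤ m2plus → ∀ (M : Fin (d + 1) → ℕ), (∀ i, 1 ≤ M i) →
        ∀ (μ : Fin (d + 1)) (x xe : ↥(boxDom (fun i => (ℓ + 1) ^ k * M i))), xe.1 = x.1 + Pi.single μ 1 →
          ∑ x', |(((ℓ + 1) ^ k : ℕ) : ℝ) *
                ((boxOpR ((ℓ + 1) ^ k) a m2 M)⁻¹ xe x' - (boxOpR ((ℓ + 1) ^ k) a m2 M)⁻¹ x x')|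
              * Real.exp (δ₀ * supNorm (x.1 - x'.1) / (((ℓ + 1) ^ k : ℕ) : ℝ)) ≤ c₀ := by
  obtain ⟨δ₀, c₀, hδ0, hc0, h⟩ :=
    thm110_zero_box_deriv_roww d ℓ hℓ amin (aplus / (1 - ((((ℓ : ℝ) + 1)) ^ 2)⁻¹)) m2plus ha
  refine ⟨δ₀, c₀, hδ0, hc0, ?_⟩
  intro k hk a m2 h1 h2 h3 h4 M hM μ x xe hxe
  obtain ⟨hr0, hr1⟩ := Linv_sq_bounds hℓ
  have hc := cK_pos hℓ hk
  have hA1 : amin ≤ a / cK ℓ k := by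
    rw [le_div_iff₀ hc]
    calc amin * cK ℓ k ≤ amin * 1 := mul_le_mul_of_nonneg_left (cK_le_one hℓ hk) ha.le
      _ ≤ a := by linarith
  have hA2 : a / cK ℓ k ≤ aplus / (1 - ((((ℓ : ℝ) + 1)) ^ 2)⁻¹) :=
    div_le_div₀ (by linarith) h2 (by linarith) (oneSub_le_cK hℓ hk)
  have := h k hk (a / cK ℓ k) m2 hA1 hA2 h3 h4 M hM μ x xe hxe
  rwa [aSeq_div_cK hℓ hk] at this

/-- … and the printed derivative clause with the literal coefficient.
[cite: Balaban1983RegularityDecay, Theorem (Prop. 2.1 of [1]) (1.10) p.573 with (1.6) p.572] -/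
theorem thm110_zero_box_deriv_value_coeff (d ℓ : ℕ) (hℓ : 1 ≤ ℓ) (amin aplus m2plus : ℝ) (ha : 0 < amin) :
    ∃ δ₀ c₀ : ℝ, 0 < δ₀ ∧ 0 < c₀ ∧ ∀ (k : ℕ), 1 ≤ k → ∀ (a m2 : ℝ), amin ≤ a → a ≤ aplus → 0 ≤ m2 →
      m2 ≤ m2plus → ∀ (M : Fin (d + 1) → ℕ), (∀ i, 1 ≤ M i) →
      ∀ (f : ↥(boxDom (fun i => (ℓ + 1) ^ k * M i)) → ℝ) (F D : ℝ), (∀ x', |f x'| ≤ F) →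
      ∀ (μ : Fin (d + 1)) (x xe : ↥(boxDom (fun i => (ℓ + 1) ^ k * M i))), xe.1 = x.1 + Pi.single μ 1 →
        (∀ x', f x' ≠ 0 → D ≤ supNorm (x.1 - x'.1)) →
        |(((ℓ + 1) ^ k : ℕ) : ℝ) *
            (((boxOpR ((ℓ + 1) ^ k) a m2 M)⁻¹ *ᵥ f) xe - ((boxOpR ((ℓ + 1) ^ k) a m2 M)⁻¹ *ᵥ f) x)|
          ≤ c₀ * Real.exp (-(δ₀ * D / (((ℓ + 1) ^ k : ℕ) : ℝ))) * F := by
  obtain ⟨δ₀, c₀, hδ0, hc0, h⟩ := thm110_zero_box_deriv_roww_coeff d ℓ hℓ amin aplus m2plus ha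
  refine ⟨δ₀, c₀, hδ0, hc0, ?_⟩
  intro k hk a m2 h1 h2 h3 h4 M hM f F D hF μ x xe hxe hD
  rw [mulVec_sub_mulVec]
  exact abs_sum_mul_le_of_wsum hδ0.le _ x _ (h k hk a m2 h1 h2 h3 h4 M hM μ x xe hxe) f hF hD

/-! ## §8 Non-vacuity: the hypotheses are met (`d + 1 = 4`, `L = 2`, window `a ∈ [1/2, 2]`, `m² ∈ [0, 1]`) -/

/-- the main theorem at the physical dimension `d + 1 = 4`, `L = 2`. -/
example : ∃ δ₀ c₀ : ℝ, 0 < δ₀ ∧ 0 < c₀ ∧ ∀ (k : ℕ), 1 ≤ k → ∀ (a m2 : ℝ), (1 / 2 : ℝ) ≤ a → a ≤ 2 → 0 ≤ m2 →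
      m2 ≤ 1 → ∀ (M : Fin (3 + 1) → ℕ), (∀ i, 1 ≤ M i) →
        ∀ (μ : Fin (3 + 1)) (x xe : ↥(boxDom (fun i => (1 + 1) ^ k * M i))), xe.1 = x.1 + Pi.single μ 1 →
          ∑ x', |(((1 + 1) ^ k : ℕ) : ℝ) *
                ((boxOpR ((1 + 1) ^ k) a m2 M)⁻¹ xe x' - (boxOpR ((1 + 1) ^ k) a m2 M)⁻¹ x x')|
              * Real.exp (δ₀ * supNorm (x.1 - x'.1) / (((1 + 1) ^ k : ℕ) : ℝ)) ≤ c₀ :=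
  thm110_zero_box_deriv_roww_coeff 3 1 le_rfl (1 / 2) 2 1 (by norm_num)

/-- the quantifier prefix of the theorems is inhabited: `k = 1`, `a = 1`, `m² = 0`, the unit cube `M ≡ 1`, the axis
`μ = 0`, and the pair of neighbours `x = 0`, `xe = e_0` of the fine box `{0,1}^4` (`xe = x + e_0`). -/
example : (1 : ℕ) ≤ 1 ∧ (1 / 2 : ℝ) ≤ 1 ∧ (1 : ℝ) ≤ 2 ∧ (0 : ℝ) ≤ 0 ∧ (0 : ℝ) ≤ 1
    ∧ (∀ i : Fin (3 + 1), 1 ≤ (fun _ => 1 : Fin (3 + 1) → ℕ) i)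
    ∧ (fun _ => (0 : ℤ)) ∈ boxDom (fun i : Fin (3 + 1) => (1 + 1) ^ 1 * (fun _ => 1 : Fin (3 + 1) → ℕ) i)
    ∧ (Pi.single (0 : Fin (3 + 1)) (1 : ℤ))
        ∈ boxDom (fun i : Fin (3 + 1) => (1 + 1) ^ 1 * (fun _ => 1 : Fin (3 + 1) → ℕ) i)
    ∧ (Pi.single (0 : Fin (3 + 1)) (1 : ℤ) : Fin (3 + 1) → ℤ) = (fun _ => (0 : ℤ)) + Pi.single 0 1 := by
  refine ⟨le_rfl, by norm_num, by norm_num, le_rfl, by norm_num, fun _ => le_rfl, ?_, ?_, ?_⟩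
  · exact mem_boxDom.2 fun _ => ⟨le_rfl, by norm_num⟩
  · refine mem_boxDom.2 fun i => ?_
    by_cases h : i = 0
    · subst h; simp
    · simp [h]
  · funext i
    simp

end

end Literature.MathematicalPhysics.QuantumFieldTheory.Balaban1983to89.B4Thm110ZeroBoxDeriv
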